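import Literature.Barriers.AtomisticToContinuum.DisorderedHarmonicChainLowerBound
import Literature.Barriers.AtomisticToContinuum.DisorderedHarmonicChainInvGammaProofs
import Mathlib.Analysis.SpecialFunctions.Trigonometric.ArctanDeriv
import Mathlib.Analysis.Calculus.MeanValue
import HarnessLib

/-!
# Ajanki–Huveneers 2011, Lemma 3.7 and Lemma 6.1: the joint behaviour of `(X^ϑ_n, X^0_n, Γ^ϑ_n, Γ^0_n)` — discharge of `AjankiHuveneers2011_jointBehaviourTails`

Companion to `DisorderedHarmonicChainLowerBound.lean` (provefact unit for the named fact
`AjankiHuveneers2011_jointBehaviourTails`: O. Ajanki, F. Huveneers, *Rigorous scaling law for the heat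
current in disordered harmonic chain*, CMP **301** (2011) 841–883, arXiv:1003.1076, §3.2 Lemma 3.7 and
§6.1 Lemma 6.1 with (6.8)–(6.9)). Everything is proved; no new named facts.

* **Lemma 3.7, (3.25) with (3.27)–(3.28) (deterministic part).** With `d_n = X^ϑ_n - X^0_n`
  (`= wΘ_n`, `jbDiff`): `d_{n+1} = d_n + Φ(X^ϑ_n,B) - Φ(X^0_n,B)` and the second-order Lipschitz estimate
  `Φ(x,b) - Φ(y,b) = wb(φ(x) - φ(y)) + 𝒪(w²|x - y|)` (`jb_ahPhi_sub_linear`, from the explicit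
  `x`-derivative of `Φ` (`jb_hasDerivAt_ahPhi`) bounded in `jb_ahPhi_deriv_bound`, and the mean value
  inequality) give `d_n > 0` and `log d_n = log ϑ + ∑_{j<n} v(X^ϑ_j,X^0_j)B_{j+1} + 𝒪(w²n)`
  (`jb_theta_recursion`) with the difference quotient `v(x,y) = w(φ(x)-φ(y))/(x-y)` (`jbGN`,
  `|v| ≤ πw`, `v = wφ' + 𝒪(w|x-y|)`), i.e. `∑ vB = M_n + L_n` with `M_n = ahMart` and the coefficient of
  `L` bounded by `3π²w·d_j`.
* **Lemma 3.7, (3.26) with (3.29).** From the per-factor expansion (3.19) (`log_ahFactor_expansion`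
  of `…PhasesProofs.lean`): `log Γ^0_n - log Γ^ϑ_n ≤ ∑_{j<n} w(s(X^0_j) - s(X^ϑ_j))B_{j+1} + C(w²n + w)`
  (`jb_gamma_ratio`), the coefficient of `K` bounded by `π²w·d_j`.
* **Lemma 4.2/4.3 (Azuma) for predictable-coefficient sums on `τ^{⊗n}`** (`jbSum`,
  `jb_lintegral_exp_jbSum_le`, `jb_azuma_tail`): `𝔼e^{t∑ g(X^x_j,X^y_j)B_{j+1}} ≤ e^{2mt²c²b_*²}` for
  `|g| ≤ c`, `|t|cb_* ≤ 1/2`, by induction splitting off the first mass (Markov property of the pair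
  chain, Tonelli over `τ ⊗ τ^{⊗n}`, and `∫e^{sb}τ ≤ e^{2s²b_*²}`, `jb_mgf_le`), then Markov's inequality.
* **Lemma 6.1 and (6.8)–(6.9)** (`AjankiHuveneers2011_jointBehaviourTails_holds`): truncating the
  coefficients of `L`, `K` on `{d_j ≤ √w}` (`jbGL`, `jbGK`, bounded by `3π²w^{3/2}`) gives
  `P(L̃_n ≥ 1), P(K̃_n ≥ 1) ≤ e^{-κ₀/w}` (`jb_trunc_tail`), the exceptional events satisfy
  `P(d_j > √w) ≤ P(N_j ≥ ¼log(1/w)) ≤ e^{-κ₁log²(1/w)}` (`jb_size_tail`), and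
  `e^{-κ₀/w} + n e^{-κ₁log²(1/w)} ≤ 2w^α` for `w ≤ w₀(α)`, `w²n ≤ 1`.

Equation numbers are those of arXiv:1003.1076v1 (the held copy): in Lemma 3.7, (3.25)–(3.26) are the two
representations, (3.27)–(3.29) the increments `ΔM`, `ΔL`, `ΔK`, (3.30) their bounds; in §6.1, (6.2) is the
bound of Lemma 6.1, (6.4)–(6.5) the truncation and the truncated Azuma bound of its proof, (6.8)–(6.9) the
two `χ`-displays (as in `DisorderedHarmonicChainLowerBound.lean`).
-/

noncomputable section

open MeasureTheory Finset Real
open scoped ENNReal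

namespace Literature.Barriers.AtomisticToContinuum.HeatConduction

/-! ### Elementary inequalities for `φ = sin²(π·)`, `φ' = π sin(2π·)`, `s = -(π/2) sin(2π·)` -/

/-- `sin² a - sin² b = sin(a + b) sin(a - b)`. [folklore] -/
theorem jb_sin_sq_sub_sin_sq (a b : ℝ) :
    Real.sin a ^ 2 - Real.sin b ^ 2 = Real.sin (a + b) * Real.sin (a - b) := by
  rw [Real.sin_add, Real.sin_sub]
  have ha := Real.sin_sq_add_cos_sq a
  have hb := Real.sin_sq_add_cos_sq b
  linear_combination (Real.sin b ^ 2) * ha + (-(Real.sin a ^ 2)) * hb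

/-- `|sin² a - sin² b| ≤ |a - b|`. [folklore] -/
theorem jb_abs_sin_sq_sub_le (a b : ℝ) : |Real.sin a ^ 2 - Real.sin b ^ 2| ≤ |a - b| := by
  rw [jb_sin_sq_sub_sin_sq, abs_mul]
  calc |Real.sin (a + b)| * |Real.sin (a - b)| ≤ 1 * |a - b| :=
        mul_le_mul (Real.abs_sin_le_one _) Real.abs_sin_le_abs (abs_nonneg _) zero_le_one
    _ = |a - b| := one_mul _

/-- `|sin u - u| ≤ 2u²` for all real `u`. [folklore] -/
theorem jb_abs_sin_sub_self_le_sq (u : ℝ) : |Real.sin u - u| ≤ 2 * u ^ 2 := by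
  rcases le_or_gt |u| 1 with h | h
  · calc |Real.sin u - u| ≤ |u| ^ 3 := abs_sin_sub_self_le h
      _ ≤ 2 * u ^ 2 := by
        rw [← sq_abs u]
        nlinarith [abs_nonneg u, sq_nonneg |u|]
  · calc |Real.sin u - u| ≤ |Real.sin u| + |u| := abs_sub _ _
      _ ≤ 1 + |u| := by gcongr; exact Real.abs_sin_le_one u
      _ ≤ 2 * u ^ 2 := by rw [← sq_abs u]; nlinarith

/-- `|sin x - sin y| ≤ |x - y|`. [folklore] -/
theorem jb_abs_sin_sub_sin_le (x y : ℝ) : |Real.sin x - Real.sin y| ≤ |x - y| := by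
  rw [Real.sin_sub_sin, abs_mul, abs_mul, abs_two]
  calc 2 * |Real.sin ((x - y) / 2)| * |Real.cos ((x + y) / 2)| ≤ 2 * |(x - y) / 2| * 1 :=
        mul_le_mul (mul_le_mul_of_nonneg_left Real.abs_sin_le_abs zero_le_two) (Real.abs_cos_le_one _)
          (abs_nonneg _) (by positivity)
    _ = |x - y| := by rw [abs_div, abs_two]; ring

/-- **Taylor bound for `φ = sin²(π·)`**: `|φ(x) - φ(y) - φ'(x)(x - y)| ≤ 2π²(x - y)²`,
`φ'(x) = π sin 2πx`. [cite: AjankiHuveneers2011, Lemma 3.7 (proof, "by the mean value theorem")] -/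
theorem jb_phi_taylor (x y : ℝ) :
    |Real.sin (π * x) ^ 2 - Real.sin (π * y) ^ 2 - π * Real.sin (2 * π * x) * (x - y)| ≤
      3 * π ^ 2 * (x - y) ^ 2 := by
  set a := π * x with ha
  set d := π * (x - y) with hd
  have hy : π * y = a - d := by rw [ha, hd]; ring
  have h1 : Real.sin a ^ 2 - Real.sin (a - d) ^ 2 = Real.sin (2 * a - d) * Real.sin d := by
    rw [jb_sin_sq_sub_sin_sq]
    congr 2 <;> ring
  have h2a : 2 * π * x = 2 * a := by rw [ha]; ring
  have h2 : |Real.sin (2 * a - d) - Real.sin (2 * a)| ≤ |d| := by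
    calc |Real.sin (2 * a - d) - Real.sin (2 * a)| ≤ |2 * a - d - 2 * a| := jb_abs_sin_sub_sin_le _ _
      _ = |d| := by rw [show 2 * a - d - 2 * a = -d by ring, abs_neg]
  have h3 := jb_abs_sin_sub_self_le_sq d
  rw [hy, h1, h2a, show π * Real.sin (2 * a) * (x - y) = Real.sin (2 * a) * d by rw [hd]; ring]
  have hsplit : Real.sin (2 * a - d) * Real.sin d - Real.sin (2 * a) * d =
      Real.sin d * (Real.sin (2 * a - d) - Real.sin (2 * a)) + Real.sin (2 * a) * (Real.sin d - d) := by
    ring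
  rw [hsplit]
  have hd2 : d ^ 2 = π ^ 2 * (x - y) ^ 2 := by rw [hd]; ring
  calc |Real.sin d * (Real.sin (2 * a - d) - Real.sin (2 * a)) + Real.sin (2 * a) * (Real.sin d - d)|
      ≤ |Real.sin d * (Real.sin (2 * a - d) - Real.sin (2 * a))| + |Real.sin (2 * a) * (Real.sin d - d)| :=
        abs_add_le _ _
    _ = |Real.sin d| * |Real.sin (2 * a - d) - Real.sin (2 * a)| + |Real.sin (2 * a)| * |Real.sin d - d| := by
        rw [abs_mul, abs_mul]
    _ ≤ |d| * |d| + 1 * (2 * d ^ 2) :=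
        add_le_add (mul_le_mul Real.abs_sin_le_abs h2 (abs_nonneg _) (abs_nonneg _))
          (mul_le_mul (Real.abs_sin_le_one _) h3 (abs_nonneg _) zero_le_one)
    _ = 3 * π ^ 2 * (x - y) ^ 2 := by rw [← sq, sq_abs, hd2]; ring

/-- `|φ(x) - φ(y)| ≤ π|x - y|`. [folklore] -/
theorem jb_abs_phi_sub_le (x y : ℝ) : |Real.sin (π * x) ^ 2 - Real.sin (π * y) ^ 2| ≤ π * |x - y| := by
  calc |Real.sin (π * x) ^ 2 - Real.sin (π * y) ^ 2| ≤ |π * x - π * y| := jb_abs_sin_sq_sub_le _ _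
    _ = π * |x - y| := by rw [← mul_sub, abs_mul, abs_of_pos Real.pi_pos]

/-- `|s(x) - s(y)| ≤ π²|x - y|` for `s = -(π/2) sin 2π·`. [folklore] -/
theorem jb_abs_ahS_sub_le (x y : ℝ) : |ahS x - ahS y| ≤ π ^ 2 * |x - y| := by
  unfold ahS
  rw [show -(π / 2) * Real.sin (2 * π * x) - -(π / 2) * Real.sin (2 * π * y) =
      -(π / 2) * (Real.sin (2 * π * x) - Real.sin (2 * π * y)) by ring, abs_mul, abs_neg,
    abs_of_pos (by positivity : (0:ℝ) < π / 2)]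
  calc π / 2 * |Real.sin (2 * π * x) - Real.sin (2 * π * y)| ≤ π / 2 * |2 * π * x - 2 * π * y| :=
        mul_le_mul_of_nonneg_left (jb_abs_sin_sub_sin_le _ _) (by positivity)
    _ = π ^ 2 * |x - y| := by
        rw [← mul_sub, abs_mul, abs_of_pos (by positivity : (0:ℝ) < 2 * π)]; ring

/-- `|log(1 + u) - u| ≤ 2u²` for `|u| ≤ 1/2`. [folklore] -/
theorem jb_abs_log_one_add_sub_self_le {u : ℝ} (hu : |u| ≤ 1 / 2) :
    |Real.log (1 + u) - u| ≤ 2 * u ^ 2 := by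
  have h := Real.abs_log_sub_add_sum_range_le (x := -u) (by rw [abs_neg]; linarith) 1
  simp only [Finset.sum_range_one, zero_add, pow_one, Nat.cast_zero, div_one, sub_neg_eq_add,
    abs_neg] at h
  have h2 : |u| ^ (1 + 1) / (1 - |u|) ≤ 2 * u ^ 2 := by
    rw [show (1 + 1 : ℕ) = 2 from rfl, sq_abs, div_le_iff₀ (by linarith)]
    nlinarith [sq_nonneg u, abs_nonneg u]
  have e : Real.log (1 + u) - u = -u + Real.log (1 + u) := by abel
  rw [e]
  exact h.trans h2

/-! ### The `x`-derivative of `Φ` and the second-order Lipschitz estimate of Lemma 3.7 -/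

/-- `d/dx N = (πw/2)(2π sin 2πx) b`. [folklore] -/
theorem jb_hasDerivAt_ahNum (w b x : ℝ) :
    HasDerivAt (fun x => ahNum w x b) (π * w / 2 * (2 * π * Real.sin (2 * π * x)) * b) x := by
  have h1 : HasDerivAt (fun x => 2 * π * x) (2 * π) x := by
    simpa using (hasDerivAt_id x).const_mul (2 * π)
  have h2 : HasDerivAt (fun x => 1 - Real.cos (2 * π * x)) (2 * π * Real.sin (2 * π * x)) x :=
    (h1.cos.const_sub 1).congr_deriv (by ring)
  have h3 := (h2.const_mul (π * w / 2)).mul_const b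
  unfold ahNum
  exact h3

/-- `d/dx D = -(πw/2)(2π cos 2πx) b`. [folklore] -/
theorem jb_hasDerivAt_ahDen (w b x : ℝ) :
    HasDerivAt (fun x => ahDen w x b) (-(π * w / 2 * (2 * π * Real.cos (2 * π * x)) * b)) x := by
  have h1 : HasDerivAt (fun x => 2 * π * x) (2 * π) x := by
    simpa using (hasDerivAt_id x).const_mul (2 * π)
  have h2 : HasDerivAt (fun x => Real.sin (2 * π * x)) (2 * π * Real.cos (2 * π * x)) x :=
    h1.sin.congr_deriv (by ring)
  have h3 := ((h2.const_mul (π * w / 2)).mul_const b).const_sub (Real.sqrt (1 - (π * w / 2) ^ 2))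
  unfold ahDen
  exact h3

/-- The `x`-derivative of `Φ(·, b)`: `Φ' = (N'D - ND') / (π (D² + N²))`.
[cite: AjankiHuveneers2011, Lemma 3.7 (proof: "`Φ(x,b) = wφ(x)b + w²R₂(x,b)` where `R₂` is a smooth and bounded function")] -/
theorem jb_hasDerivAt_ahPhi {w b : ℝ} (hw0 : 0 ≤ w) (hwb : π * w / 2 * (1 + |b|) < 1) (x : ℝ) :
    HasDerivAt (fun x => ahPhi w x b)
      ((π * w / 2 * (2 * π * Real.sin (2 * π * x)) * b * ahDen w x b -
          ahNum w x b * -(π * w / 2 * (2 * π * Real.cos (2 * π * x)) * b)) /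
        (π * (ahDen w x b ^ 2 + ahNum w x b ^ 2))) x := by
  have hD := ahDen_pos (x := x) hw0 hwb
  have hD' : ahDen w x b ≠ 0 := hD.ne'
  have hπ : π ≠ 0 := Real.pi_pos.ne'
  have hDN : ahDen w x b ^ 2 + ahNum w x b ^ 2 ≠ 0 := by positivity
  have h1N : 1 + (ahNum w x b / ahDen w x b) ^ 2 ≠ 0 := by positivity
  have hq := ((jb_hasDerivAt_ahNum w b x).div (jb_hasDerivAt_ahDen w b x) hD').arctan.div_const π
  have heq : 1 / (1 + (ahNum w x b / ahDen w x b) ^ 2) *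
      ((π * w / 2 * (2 * π * Real.sin (2 * π * x)) * b * ahDen w x b -
          ahNum w x b * -(π * w / 2 * (2 * π * Real.cos (2 * π * x)) * b)) / ahDen w x b ^ 2) / π =
      (π * w / 2 * (2 * π * Real.sin (2 * π * x)) * b * ahDen w x b -
          ahNum w x b * -(π * w / 2 * (2 * π * Real.cos (2 * π * x)) * b)) /
        (π * (ahDen w x b ^ 2 + ahNum w x b ^ 2)) := by
    field_simp
  simp only [Pi.div_apply] at hq
  rw [heq] at hq
  unfold ahPhi
  exact hq

/-- **Real-variable core of the derivative bound**: with `S = sin πx`, `Cc = cos πx`, `t = πw/2`,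
`q₀ = √(1-t²)`, the quantity `Φ' - wbφ'` is `𝒪(t²)`. [cite: AjankiHuveneers2011, Lemma 3.7 (proof)] -/
theorem jb_deriv_core {S Cc t q₀ b M : ℝ} (hSC : S ^ 2 + Cc ^ 2 = 1) (hq0 : 3 / 4 ≤ q₀) (hq1 : q₀ ≤ 1)
    (hqt : 1 - q₀ ≤ t ^ 2) (ht0 : 0 ≤ t) (ht1 : t ≤ 1) (hM0 : 0 ≤ M) (hbM : |b| ≤ M)
    (htM : t * M ≤ 1 / 4) :
    |4 * π * t * b * (q₀ * S * Cc - t * b * S ^ 2) /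
          (π * (q₀ ^ 2 - 4 * t * q₀ * b * S * Cc + 4 * t ^ 2 * b ^ 2 * S ^ 2)) - 4 * t * b * S * Cc| ≤
      16 * t ^ 2 * M * (1 + 6 * M) := by
  have hπ := Real.pi_pos
  have hS2 : S ^ 2 ≤ 1 := by nlinarith [sq_nonneg Cc]
  have hC2 : Cc ^ 2 ≤ 1 := by nlinarith [sq_nonneg S]
  have hSC2 : |S * Cc| ≤ 1 / 2 := by
    rw [abs_le]; constructor <;> nlinarith [sq_nonneg (S + Cc), sq_nonneg (S - Cc)]
  have htb : |t * b| ≤ t * M := by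
    rw [abs_mul, abs_of_nonneg ht0]; exact mul_le_mul_of_nonneg_left hbM ht0
  have htb4 : |t * b| ≤ 1 / 4 := htb.trans htM
  set E := q₀ ^ 2 - 4 * t * q₀ * b * S * Cc + 4 * t ^ 2 * b ^ 2 * S ^ 2 with hE
  have hE_ge : 1 / 4 ≤ E := by
    have h1 : E = (q₀ - 2 * (t * b) * (S * Cc)) ^ 2 + 4 * (t * b) ^ 2 * S ^ 2 * (1 - Cc ^ 2) := by
      rw [hE]; ring
    have h3 : |2 * (t * b) * (S * Cc)| ≤ 1 / 4 := by
      rw [abs_mul, abs_mul, abs_two]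
      calc 2 * |t * b| * |S * Cc| ≤ 2 * (1 / 4) * (1 / 2) := by gcongr
        _ = 1 / 4 := by norm_num
    have h4 : 1 / 2 ≤ q₀ - 2 * (t * b) * (S * Cc) := by linarith [(abs_le.mp h3).2]
    have h5 : 0 ≤ 4 * (t * b) ^ 2 * S ^ 2 * (1 - Cc ^ 2) := by
      have : 0 ≤ 1 - Cc ^ 2 := by linarith
      positivity
    rw [h1]; nlinarith
  have hE0 : 0 < E := by linarith
  set Bk := (1 - q₀) * (q₀ * (S * Cc)) +
    (t * b) * (-S ^ 2 + 4 * q₀ * S ^ 2 * Cc ^ 2 - 4 * (t * b) * S ^ 2 * (S * Cc)) with hBk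
  have hexpr : 4 * π * t * b * (q₀ * S * Cc - t * b * S ^ 2) / (π * E) - 4 * t * b * S * Cc =
      4 * (t * b) * Bk / E := by
    rw [hBk, eq_div_iff hE0.ne']
    field_simp
    rw [hE]
    ring
  rw [hexpr]
  have hB1 : |(1 - q₀) * (q₀ * (S * Cc))| ≤ t ^ 2 * (1 * (1 / 2)) := by
    rw [abs_mul, abs_mul, abs_of_nonneg (by linarith : 0 ≤ 1 - q₀),
      abs_of_nonneg (by linarith : (0:ℝ) ≤ q₀)]
    gcongr
  have hB2 : |-S ^ 2 + 4 * q₀ * S ^ 2 * Cc ^ 2 - 4 * (t * b) * S ^ 2 * (S * Cc)| ≤ 6 := by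
    have e1 : |-S ^ 2| ≤ 1 := by rw [abs_neg, abs_of_nonneg (sq_nonneg _)]; exact hS2
    have e2 : |4 * q₀ * S ^ 2 * Cc ^ 2| ≤ 4 := by
      rw [abs_of_nonneg (by positivity)]
      calc 4 * q₀ * S ^ 2 * Cc ^ 2 ≤ 4 * 1 * 1 * 1 := by gcongr
        _ = 4 := by norm_num
    have e3 : |4 * (t * b) * S ^ 2 * (S * Cc)| ≤ 1 := by
      rw [abs_mul, abs_mul, abs_mul, abs_of_nonneg (sq_nonneg S),
        abs_of_pos (by norm_num : (0:ℝ) < 4)]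
      calc 4 * |t * b| * S ^ 2 * |S * Cc| ≤ 4 * (1 / 4) * 1 * (1 / 2) := by gcongr
        _ ≤ 1 := by norm_num
    calc |-S ^ 2 + 4 * q₀ * S ^ 2 * Cc ^ 2 - 4 * (t * b) * S ^ 2 * (S * Cc)|
        ≤ |-S ^ 2 + 4 * q₀ * S ^ 2 * Cc ^ 2| + |4 * (t * b) * S ^ 2 * (S * Cc)| := abs_sub _ _
      _ ≤ (|-S ^ 2| + |4 * q₀ * S ^ 2 * Cc ^ 2|) + |4 * (t * b) * S ^ 2 * (S * Cc)| := by
          gcongr; exact abs_add_le _ _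
      _ ≤ (1 + 4) + 1 := by gcongr
      _ = 6 := by norm_num
  have hBk_le : |Bk| ≤ t ^ 2 * (1 * (1 / 2)) + t * M * 6 := by
    calc |Bk| ≤ |(1 - q₀) * (q₀ * (S * Cc))| +
          |(t * b) * (-S ^ 2 + 4 * q₀ * S ^ 2 * Cc ^ 2 - 4 * (t * b) * S ^ 2 * (S * Cc))| :=
          abs_add_le _ _
      _ ≤ t ^ 2 * (1 * (1 / 2)) + (t * M) * 6 := by
          gcongr
          rw [abs_mul]
          exact mul_le_mul htb hB2 (abs_nonneg _) (by positivity)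
  rw [abs_div, abs_of_pos hE0, div_le_iff₀ hE0, abs_mul, abs_mul, abs_of_pos (by norm_num : (0:ℝ) < 4)]
  calc 4 * |t * b| * |Bk| ≤ 4 * (t * M) * (t ^ 2 * (1 * (1 / 2)) + t * M * 6) := by gcongr
    _ = 16 * t ^ 2 * M * (t / 2 + 6 * M) * (1 / 4) := by ring
    _ ≤ 16 * t ^ 2 * M * (1 + 6 * M) * E := by
        gcongr
        linarith

/-- **`|∂ₓΦ(x,b) - wbφ'(x)| ≤ 4π²M(1+6M) w²`** for `|b| ≤ M`, `πw(1 + M) ≤ 1/2` (`φ' = π sin 2π·`): the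
first-order term of `Φ` in `w` is `wbφ(x)` at the level of `x`-derivatives ("`∂ₓR₂` bounded").
[cite: AjankiHuveneers2011, Lemma 3.7 (proof)] -/
theorem jb_ahPhi_deriv_bound {w b M : ℝ} (hw0 : 0 < w) (hM0 : 0 ≤ M) (hbM : |b| ≤ M)
    (hwM : π * w * (1 + M) ≤ 1 / 2) (x : ℝ) :
    |(π * w / 2 * (2 * π * Real.sin (2 * π * x)) * b * ahDen w x b -
          ahNum w x b * -(π * w / 2 * (2 * π * Real.cos (2 * π * x)) * b)) /
        (π * (ahDen w x b ^ 2 + ahNum w x b ^ 2)) - w * b * (π * Real.sin (2 * π * x))| ≤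
      4 * π ^ 2 * M * (1 + 6 * M) * w ^ 2 := by
  have hπ := Real.pi_pos
  set t := π * w / 2 with ht
  have ht0 : 0 ≤ t := by positivity
  have hπw : π * w ≤ 1 / 2 := by nlinarith [mul_pos hπ hw0]
  have ht1 : t ≤ 1 := by rw [ht]; linarith
  have htM : t * M ≤ 1 / 4 := by rw [ht]; nlinarith [mul_pos hπ hw0]
  obtain ⟨hq0, hq1⟩ := ahSqrt_bounds hw0.le hπw
  set q₀ := Real.sqrt (1 - (π * w / 2) ^ 2) with hq₀
  have hq_sq : q₀ ^ 2 = 1 - t ^ 2 := by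
    rw [hq₀, ht, Real.sq_sqrt]; nlinarith
  have hqt : 1 - q₀ ≤ t ^ 2 := by
    have h1 : 1 - t ^ 2 ≤ q₀ := by
      rw [hq₀, ← ht]
      apply Real.le_sqrt_of_sq_le
      nlinarith
    linarith
  set S := Real.sin (π * x) with hS
  set Cc := Real.cos (π * x) with hCc
  have hSC : S ^ 2 + Cc ^ 2 = 1 := Real.sin_sq_add_cos_sq _
  have hs2 : Real.sin (2 * π * x) = 2 * S * Cc := by
    rw [show 2 * π * x = 2 * (π * x) by ring, Real.sin_two_mul]
  have hc2 : Real.cos (2 * π * x) = Cc ^ 2 - S ^ 2 := by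
    rw [show 2 * π * x = 2 * (π * x) by ring, Real.cos_two_mul, ← hCc]
    linarith
  have hN : ahNum w x b = 2 * t * b * S ^ 2 := by rw [ahNum_eq, ht]; ring
  have hD : ahDen w x b = q₀ - 2 * t * b * S * Cc := by rw [ahDen_eq, ← hq₀, ht]; ring
  have hcore := jb_deriv_core hSC hq0 hq1 hqt ht0 ht1 hM0 hbM htM
  have hnum : π * w / 2 * (2 * π * Real.sin (2 * π * x)) * b * ahDen w x b -
      ahNum w x b * -(π * w / 2 * (2 * π * Real.cos (2 * π * x)) * b) =
      4 * π * t * b * (q₀ * S * Cc - t * b * S ^ 2) := by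
    rw [hs2, hc2, hN, hD, ht]
    linear_combination (-(4 * π * (π * w / 2) ^ 2 * b ^ 2 * S ^ 2)) * hSC
  have hden : ahDen w x b ^ 2 + ahNum w x b ^ 2 =
      q₀ ^ 2 - 4 * t * q₀ * b * S * Cc + 4 * t ^ 2 * b ^ 2 * S ^ 2 := by
    rw [hN, hD]
    linear_combination (4 * t ^ 2 * b ^ 2 * S ^ 2) * hSC
  have hlin : w * b * (π * Real.sin (2 * π * x)) = 4 * t * b * S * Cc := by rw [hs2, ht]; ring
  rw [hnum, hden, hlin]
  calc _ ≤ 16 * t ^ 2 * M * (1 + 6 * M) := hcore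
    _ = 4 * π ^ 2 * M * (1 + 6 * M) * w ^ 2 := by rw [ht]; ring

/-- **(3.31)–(3.32), the second-order Lipschitz estimate of `Φ`**:
`|Φ(x,b) - Φ(y,b) - wb(φ(x) - φ(y))| ≤ C w² |x - y|` for `0 < w ≤ w₀`, `b ∈ [b₋, b₊]`, all real `x, y`
(`φ = sin²π·`; "`Φ(x,b) - Φ(x-z,b) = {wb(φ(x)-φ(x-z))/z + w²(R₂(x,b) - R₂(x-z,b))/z} z`" with `∂ₓR₂`
bounded; mean value theorem). [cite: AjankiHuveneers2011, Lemma 3.7 (proof: the two displays for `f_b(x) - f_b(x-z)`)] -/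
theorem jb_ahPhi_sub_linear (bm bp : ℝ) :
    ∃ w₀ : ℝ, 0 < w₀ ∧ w₀ ≤ 1 ∧ ∃ C : ℝ, 0 ≤ C ∧ ∀ w ∈ Set.Ioc 0 w₀, ∀ b ∈ Set.Icc bm bp, ∀ x y : ℝ,
      |ahPhi w x b - ahPhi w y b - w * b * (Real.sin (π * x) ^ 2 - Real.sin (π * y) ^ 2)| ≤
        C * w ^ 2 * |x - y| := by
  obtain ⟨M, hM⟩ : ∃ M : ℝ, M = max |bm| |bp| := ⟨_, rfl⟩
  have hM0 : 0 ≤ M := hM ▸ le_max_of_le_left (abs_nonneg _)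
  have hπ := Real.pi_pos
  refine ⟨min 1 (1 / (2 * π * (1 + M))), by positivity, min_le_left _ _,
    4 * π ^ 2 * M * (1 + 6 * M), by positivity, ?_⟩
  intro w hw b hb x y
  obtain ⟨hw0, hw1⟩ := hw
  have hbM : |b| ≤ M := hM ▸ ReducedLawHyp.abs_le_of_mem hb
  have hwM : π * w * (1 + M) ≤ 1 / 2 := by
    have h1 : w ≤ 1 / (2 * π * (1 + M)) := hw1.trans (min_le_right _ _)
    calc π * w * (1 + M) ≤ π * (1 / (2 * π * (1 + M))) * (1 + M) := by gcongr
      _ = 1 / 2 := by field_simp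
  have hwb : π * w / 2 * (1 + |b|) < 1 := by nlinarith [mul_pos hπ hw0, abs_nonneg b]
  set C := 4 * π ^ 2 * M * (1 + 6 * M) with hC
  -- the function `g = Φ(·, b) - wbφ` has derivative bounded by `C w²`
  set g : ℝ → ℝ := fun z => ahPhi w z b - w * b * Real.sin (π * z) ^ 2 with hg
  have hderiv : ∀ z, HasDerivAt g
      ((π * w / 2 * (2 * π * Real.sin (2 * π * z)) * b * ahDen w z b -
          ahNum w z b * -(π * w / 2 * (2 * π * Real.cos (2 * π * z)) * b)) /
        (π * (ahDen w z b ^ 2 + ahNum w z b ^ 2)) - w * b * (π * Real.sin (2 * π * z))) z := by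
    intro z
    have h1 := jb_hasDerivAt_ahPhi hw0.le hwb z
    have h2 : HasDerivAt (fun z => Real.sin (π * z) ^ 2) (π * Real.sin (2 * π * z)) z := by
      have h3 : HasDerivAt (fun z => π * z) π z := by simpa using (hasDerivAt_id z).const_mul π
      have h4 := h3.sin.mul h3.sin
      have e1 : (fun y => Real.sin (π * y) ^ 2) = fun y => Real.sin (π * y) * Real.sin (π * y) := by
        funext y; ring
      have e2 : π * Real.sin (2 * π * z) =
          Real.cos (π * z) * π * Real.sin (π * z) + Real.sin (π * z) * (Real.cos (π * z) * π) := by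
        rw [show 2 * π * z = 2 * (π * z) by ring, Real.sin_two_mul]; ring
      rw [e1, e2]
      exact h4
    exact h1.sub (h2.const_mul (w * b))
  have hbound : ∀ z, ‖(π * w / 2 * (2 * π * Real.sin (2 * π * z)) * b * ahDen w z b -
          ahNum w z b * -(π * w / 2 * (2 * π * Real.cos (2 * π * z)) * b)) /
        (π * (ahDen w z b ^ 2 + ahNum w z b ^ 2)) - w * b * (π * Real.sin (2 * π * z))‖ ≤ C * w ^ 2 := by
    intro z
    rw [Real.norm_eq_abs]
    exact jb_ahPhi_deriv_bound hw0 hM0 hbM hwM z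
  have hmvt := Convex.norm_image_sub_le_of_norm_hasDerivWithin_le (f := g) (s := Set.univ)
    (fun z _ => (hderiv z).hasDerivWithinAt) (fun z _ => hbound z) convex_univ (Set.mem_univ y)
    (Set.mem_univ x)
  rw [Real.norm_eq_abs, Real.norm_eq_abs] at hmvt
  calc |ahPhi w x b - ahPhi w y b - w * b * (Real.sin (π * x) ^ 2 - Real.sin (π * y) ^ 2)|
      = |g x - g y| := by rw [hg]; ring_nf
    _ ≤ C * w ^ 2 * |x - y| := hmvt

/-! ### Lemma 3.7: the two chains `X^ϑ`, `X^0` and the coefficient functions of `M`, `L`, `K` -/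

/-- The difference `d_n = X^ϑ_n - X^0_n` (`= wΘ_n` in the paper's notation) of the two lifted chains
driven by the same disorder. [cite: AjankiHuveneers2011, Lemma 3.7 (proof: `Θ_n := (X^ϑ_n - X^0_n)/w`)] -/
def jbDiff (w : ℝ) (B : ℕ → ℝ) (n : ℕ) : ℝ := ahPhase w (ahTheta w) B n - ahPhase w 0 B n

/-- The difference quotient `v(x, y) = w(φ(x) - φ(y))/(x - y)`, `φ = sin²π·`: the coefficient of `B_n`
in `ΔΘ_n/Θ_{n-1}` at first order (`= wφ'(x) + 𝒪(w|x-y|)`). [cite: AjankiHuveneers2011, Lemma 3.7 (proof: the displays for `f_b(x) - f_b(x-z)`)] -/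
def jbGN (w x y : ℝ) : ℝ := w * (Real.sin (π * x) ^ 2 - Real.sin (π * y) ^ 2) / (x - y)

/-- The truncated coefficient of the martingale `L`: `v(x,y) - wφ'(x)` on `{0 < x - y ≤ √w}`, else `0`
(the truncation `Ã_n = A_n χ_{[0,1]}(w^{1/2}A_n)` of the proof of Lemma 6.1).
[cite: AjankiHuveneers2011, Lemma 3.7 eq. (3.28) and Lemma 6.1 (proof)] -/
def jbGL (w x y : ℝ) : ℝ :=
  if 0 < x - y ∧ x - y ≤ Real.sqrt w then jbGN w x y - w * (π * Real.sin (2 * π * x)) else 0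

/-- The truncated coefficient of the martingale `K`: `w(s(y) - s(x))` on `{0 < x - y ≤ √w}`, else `0`.
[cite: AjankiHuveneers2011, Lemma 3.7 eq. (3.29) and Lemma 6.1 (proof)] -/
def jbGK (w x y : ℝ) : ℝ :=
  if 0 < x - y ∧ x - y ≤ Real.sqrt w then w * (ahS y - ahS x) else 0

/-- `d_0 = ϑ`. [folklore] -/
theorem jbDiff_zero (w : ℝ) (B : ℕ → ℝ) : jbDiff w B 0 = ahTheta w := by simp [jbDiff]

/-- `d_{n+1} = d_n + Φ(X^ϑ_n, B_{n+1}) - Φ(X^0_n, B_{n+1})`. [cite: AjankiHuveneers2011, Lemma 3.7 (proof: `f_b(x) - f_b(x-z) = z + Φ(x,b) - Φ(x-z,b)`)] -/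
theorem jbDiff_succ (w : ℝ) (B : ℕ → ℝ) (n : ℕ) :
    jbDiff w B (n + 1) = jbDiff w B n +
      (ahPhi w (ahPhase w (ahTheta w) B n) (B n) - ahPhi w (ahPhase w 0 B n) (B n)) := by
  simp only [jbDiff, ahPhase_succ, ahStep]
  ring

/-- `|v(x,y)| ≤ πw`. [folklore] -/
theorem abs_jbGN_le {w : ℝ} (hw : 0 ≤ w) (x y : ℝ) : |jbGN w x y| ≤ π * w := by
  unfold jbGN
  by_cases hxy : x - y = 0
  · rw [hxy, div_zero, abs_zero]; positivity
  · rw [abs_div, div_le_iff₀ (abs_pos.mpr hxy), abs_mul, abs_of_nonneg hw]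
    calc w * |Real.sin (π * x) ^ 2 - Real.sin (π * y) ^ 2| ≤ w * (π * |x - y|) :=
          mul_le_mul_of_nonneg_left (jb_abs_phi_sub_le x y) hw
      _ = π * w * |x - y| := by ring

/-- `v(x,y)·b = wb(φ(x) - φ(y))/(x - y)`. [folklore] -/
theorem jbGN_mul (w x y b : ℝ) :
    jbGN w x y * b = w * b * (Real.sin (π * x) ^ 2 - Real.sin (π * y) ^ 2) / (x - y) := by
  unfold jbGN; ring

/-- `|v(x,y) - wφ'(x)| ≤ 3π² w |x - y|` (`x ≠ y`). [cite: AjankiHuveneers2011, Lemma 3.7 (proof, "by the mean value theorem")] -/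
theorem abs_jbGN_sub_le {w : ℝ} (hw : 0 ≤ w) {x y : ℝ} (hxy : x ≠ y) :
    |jbGN w x y - w * (π * Real.sin (2 * π * x))| ≤ 3 * π ^ 2 * w * |x - y| := by
  have hd : x - y ≠ 0 := sub_ne_zero.mpr hxy
  have hd0 : 0 < |x - y| := abs_pos.mpr hd
  unfold jbGN
  have : w * (Real.sin (π * x) ^ 2 - Real.sin (π * y) ^ 2) / (x - y) - w * (π * Real.sin (2 * π * x)) =
      w * (Real.sin (π * x) ^ 2 - Real.sin (π * y) ^ 2 - π * Real.sin (2 * π * x) * (x - y)) / (x - y) := by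
    field_simp
  rw [this, abs_div, div_le_iff₀ hd0, abs_mul, abs_of_nonneg hw]
  calc w * |Real.sin (π * x) ^ 2 - Real.sin (π * y) ^ 2 - π * Real.sin (2 * π * x) * (x - y)|
      ≤ w * (3 * π ^ 2 * (x - y) ^ 2) := mul_le_mul_of_nonneg_left (jb_phi_taylor x y) hw
    _ = 3 * π ^ 2 * w * |x - y| * |x - y| := by rw [mul_assoc (3 * π ^ 2 * w), ← sq, sq_abs]; ring

/-- `|gL| ≤ 3π² w √w`. [cite: AjankiHuveneers2011, Lemma 6.1 (proof)] -/
theorem abs_jbGL_le {w : ℝ} (hw : 0 ≤ w) (x y : ℝ) : |jbGL w x y| ≤ 3 * π ^ 2 * w * Real.sqrt w := by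
  unfold jbGL
  split_ifs with h
  · obtain ⟨h1, h2⟩ := h
    have hxy : x ≠ y := fun e => by rw [e, sub_self] at h1; exact lt_irrefl _ h1
    calc |jbGN w x y - w * (π * Real.sin (2 * π * x))| ≤ 3 * π ^ 2 * w * |x - y| := abs_jbGN_sub_le hw hxy
      _ ≤ 3 * π ^ 2 * w * Real.sqrt w := by
          rw [abs_of_pos h1]
          exact mul_le_mul_of_nonneg_left h2 (by positivity)
  · rw [abs_zero]; positivity

/-- `|gK| ≤ π² w √w`. [cite: AjankiHuveneers2011, Lemma 6.1 (proof)] -/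
theorem abs_jbGK_le {w : ℝ} (hw : 0 ≤ w) (x y : ℝ) : |jbGK w x y| ≤ π ^ 2 * w * Real.sqrt w := by
  unfold jbGK
  split_ifs with h
  · obtain ⟨h1, h2⟩ := h
    rw [abs_mul, abs_of_nonneg hw]
    calc w * |ahS y - ahS x| ≤ w * (π ^ 2 * |y - x|) := mul_le_mul_of_nonneg_left (jb_abs_ahS_sub_le y x) hw
      _ = π ^ 2 * w * |x - y| := by rw [abs_sub_comm]; ring
      _ ≤ π ^ 2 * w * Real.sqrt w := by
          rw [abs_of_pos h1]
          exact mul_le_mul_of_nonneg_left h2 (by positivity)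
  · rw [abs_zero]; positivity

/-- `v` is jointly Borel. [folklore] -/
theorem measurable_jbGN (w : ℝ) : Measurable fun p : ℝ × ℝ => jbGN w p.1 p.2 := by
  unfold jbGN
  fun_prop

/-- The truncation set `{0 < x - y ≤ √w}` is Borel. [folklore] -/
theorem measurableSet_jbTrunc (w : ℝ) :
    MeasurableSet {p : ℝ × ℝ | 0 < p.1 - p.2 ∧ p.1 - p.2 ≤ Real.sqrt w} :=
  (measurableSet_lt measurable_const (measurable_fst.sub measurable_snd)).inter
    (measurableSet_le (measurable_fst.sub measurable_snd) measurable_const)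

/-- `gL` is jointly Borel. [folklore] -/
theorem measurable_jbGL (w : ℝ) : Measurable fun p : ℝ × ℝ => jbGL w p.1 p.2 := by
  unfold jbGL
  refine Measurable.ite (measurableSet_jbTrunc w) ?_ measurable_const
  exact (measurable_jbGN w).sub (by fun_prop)

/-- `gK` is jointly Borel. [folklore] -/
theorem measurable_jbGK (w : ℝ) : Measurable fun p : ℝ × ℝ => jbGK w p.1 p.2 := by
  unfold jbGK ahS
  refine Measurable.ite (measurableSet_jbTrunc w) ?_ measurable_const
  fun_prop

/-- **One step of the `Θ`-recursion** (3.33): if `|Φ(x,b) - Φ(y,b) - wb(φ(x)-φ(y))| ≤ C_Φ w²|x - y|`,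
`|b| ≤ M`, `(πM + C_Φ)w ≤ 1/2`, `w ≤ 1` and `d = x - y > 0`, then `d' = d + Φ(x,b) - Φ(y,b) > 0` and
`|log d' - log d - v(x,y) b| ≤ (2(πM + C_Φ)² + C_Φ) w²` ("`Θ_n = exp[wφ'(X^ϑ_{n-1})B_n - w²Θ_{n-1}…B_n +
𝒪(w²)] Θ_{n-1}`"). [cite: AjankiHuveneers2011, Lemma 3.7 (proof: the recursion for `Θ_n`)] -/
theorem jb_theta_step {w b M CΦ x y : ℝ} (hw0 : 0 < w) (hw1 : w ≤ 1) (hM0 : 0 ≤ M) (hbM : |b| ≤ M)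
    (hCΦ : 0 ≤ CΦ) (hsmall : (π * M + CΦ) * w ≤ 1 / 2)
    (hΦ : |ahPhi w x b - ahPhi w y b - w * b * (Real.sin (π * x) ^ 2 - Real.sin (π * y) ^ 2)| ≤
      CΦ * w ^ 2 * |x - y|) (hd : 0 < x - y) :
    0 < x - y + (ahPhi w x b - ahPhi w y b) ∧
      |Real.log (x - y + (ahPhi w x b - ahPhi w y b)) - Real.log (x - y) - jbGN w x y * b| ≤
        (2 * (π * M + CΦ) ^ 2 + CΦ) * w ^ 2 := by
  set d := x - y with hd_def
  set D := ahPhi w x b - ahPhi w y b with hD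
  set u := D / d with hu
  have hdu : d + D = d * (1 + u) := by rw [hu]; field_simp
  -- `|D| ≤ C₁ w d`
  have hlin : |w * b * (Real.sin (π * x) ^ 2 - Real.sin (π * y) ^ 2)| ≤ π * M * w * d := by
    rw [abs_mul, abs_mul, abs_of_pos hw0]
    calc w * |b| * |Real.sin (π * x) ^ 2 - Real.sin (π * y) ^ 2| ≤ w * M * (π * |x - y|) :=
          mul_le_mul (mul_le_mul_of_nonneg_left hbM hw0.le) (jb_abs_phi_sub_le x y) (abs_nonneg _)
            (by positivity)
      _ = π * M * w * d := by rw [abs_of_pos hd]; ring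
  have hD_le : |D| ≤ (π * M + CΦ) * w * d := by
    have h1 : |D| ≤ |D - w * b * (Real.sin (π * x) ^ 2 - Real.sin (π * y) ^ 2)| +
        |w * b * (Real.sin (π * x) ^ 2 - Real.sin (π * y) ^ 2)| := by
      have := abs_add_le (D - w * b * (Real.sin (π * x) ^ 2 - Real.sin (π * y) ^ 2))
        (w * b * (Real.sin (π * x) ^ 2 - Real.sin (π * y) ^ 2))
      rwa [sub_add_cancel] at this
    rw [abs_of_pos hd] at hΦ
    have hw2 : CΦ * w ^ 2 * d ≤ CΦ * w * d := by
      have : w ^ 2 ≤ w := by nlinarith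
      have hd0 := hd.le
      nlinarith [mul_nonneg hCΦ hd0]
    calc |D| ≤ CΦ * w ^ 2 * d + π * M * w * d := h1.trans (add_le_add hΦ hlin)
      _ ≤ CΦ * w * d + π * M * w * d := by linarith
      _ = (π * M + CΦ) * w * d := by ring
  have hu_le : |u| ≤ (π * M + CΦ) * w := by
    rw [hu, abs_div, abs_of_pos hd, div_le_iff₀ hd]
    exact hD_le
  have hu_half : |u| ≤ 1 / 2 := hu_le.trans hsmall
  have h1u : 0 < 1 + u := by linarith [(abs_le.mp hu_half).1]
  have hpos : 0 < d + D := by rw [hdu]; positivity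
  refine ⟨hpos, ?_⟩
  have hlog : Real.log (d + D) - Real.log d = Real.log (1 + u) := by
    rw [hdu, Real.log_mul hd.ne' h1u.ne']; ring
  have e1 := jb_abs_log_one_add_sub_self_le hu_half
  have e2 : |u - jbGN w x y * b| ≤ CΦ * w ^ 2 := by
    rw [jbGN_mul, hu, ← hd_def, ← sub_div, abs_div, abs_of_pos hd, div_le_iff₀ hd]
    calc |D - w * b * (Real.sin (π * x) ^ 2 - Real.sin (π * y) ^ 2)| ≤ CΦ * w ^ 2 * |x - y| := hΦ
      _ = CΦ * w ^ 2 * d := by rw [abs_of_pos hd]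
  have e3 : 2 * u ^ 2 ≤ 2 * (π * M + CΦ) ^ 2 * w ^ 2 := by
    have := (sq_abs u).symm
    have h0 : 0 ≤ (π * M + CΦ) * w := by positivity
    nlinarith [pow_le_pow_left₀ (abs_nonneg u) hu_le 2]
  calc |Real.log (d + D) - Real.log d - jbGN w x y * b|
      = |(Real.log (1 + u) - u) + (u - jbGN w x y * b)| := by rw [hlog]; ring_nf
    _ ≤ |Real.log (1 + u) - u| + |u - jbGN w x y * b| := abs_add_le _ _
    _ ≤ 2 * u ^ 2 + CΦ * w ^ 2 := add_le_add e1 e2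
    _ ≤ (2 * (π * M + CΦ) ^ 2 + CΦ) * w ^ 2 := by nlinarith

/-- **Lemma 3.7, (3.25): `Θ_n = Θ_0 e^{M_n + L_n + 𝒪(w²n)}` in the form used by Lemma 6.1.** For
`-∞ < b₋ ≤ b₊ < ∞` there are `w₀ ∈ (0, 1]` and `C₃ ≥ 0` such that for `0 < w ≤ w₀` and every disorder
sequence `B ∈ [b₋, b₊]^ℕ`, the difference `d_n = X^ϑ_n - X^0_n` stays positive and
`|log d_n - log ϑ - ∑_{j<n} v(X^ϑ_j, X^0_j) B_{j+1}| ≤ C₃ w² n` for all `n`, where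
`∑_j v(X^ϑ_j, X^0_j)B_{j+1} = M_n + L_n` (`v = wφ' + (v - wφ')`; `M_n = ahMart`).
[cite: AjankiHuveneers2011, Lemma 3.7 eq. (3.25) with (3.27)-(3.28), and its proof] -/
theorem jb_theta_recursion (bm bp : ℝ) :
    ∃ w₀ : ℝ, 0 < w₀ ∧ w₀ ≤ 1 ∧ ∃ C₃ : ℝ, 0 ≤ C₃ ∧ ∀ w ∈ Set.Ioc 0 w₀, ∀ B : ℕ → ℝ,
      (∀ k, B k ∈ Set.Icc bm bp) →
      (∀ n, 0 < jbDiff w B n) ∧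
      ∀ n, |Real.log (jbDiff w B n) - Real.log (ahTheta w) -
          ∑ j ∈ Finset.range n, jbGN w (ahPhase w (ahTheta w) B j) (ahPhase w 0 B j) * B j| ≤
        C₃ * w ^ 2 * n := by
  obtain ⟨w₁, hw₁, hw₁1, CΦ, hCΦ, hΦ⟩ := jb_ahPhi_sub_linear bm bp
  obtain ⟨M, hM⟩ : ∃ M : ℝ, M = max |bm| |bp| := ⟨_, rfl⟩
  have hM0 : 0 ≤ M := hM ▸ le_max_of_le_left (abs_nonneg _)
  have hπ := Real.pi_pos
  set C₁ := π * M + CΦ with hC₁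
  have hC₁0 : 0 ≤ C₁ := by positivity
  refine ⟨min w₁ (1 / (2 * C₁ + 2)), by positivity, (min_le_left _ _).trans hw₁1,
    2 * C₁ ^ 2 + CΦ, by positivity, ?_⟩
  intro w hw B hB
  obtain ⟨hw0, hwle⟩ := hw
  have hww₁ : w ∈ Set.Ioc 0 w₁ := ⟨hw0, hwle.trans (min_le_left _ _)⟩
  have hw1 : w ≤ 1 := hww₁.2.trans hw₁1
  have hsmall : C₁ * w ≤ 1 / 2 := by
    have h1 : w ≤ 1 / (2 * C₁ + 2) := hwle.trans (min_le_right _ _)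
    have h2 : C₁ * w ≤ C₁ * (1 / (2 * C₁ + 2)) := mul_le_mul_of_nonneg_left h1 hC₁0
    have h3 : C₁ * (1 / (2 * C₁ + 2)) ≤ 1 / 2 := by
      rw [mul_one_div, div_le_iff₀ (by positivity)]; linarith
    linarith
  have hbM : ∀ k, |B k| ≤ M := fun k => hM ▸ ReducedLawHyp.abs_le_of_mem (hB k)
  -- one step along the trajectory
  have hstep : ∀ n, 0 < jbDiff w B n → 0 < jbDiff w B (n + 1) ∧
      |Real.log (jbDiff w B (n + 1)) - Real.log (jbDiff w B n) -
        jbGN w (ahPhase w (ahTheta w) B n) (ahPhase w 0 B n) * B n| ≤ (2 * C₁ ^ 2 + CΦ) * w ^ 2 := by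
    intro n hn
    have h := jb_theta_step hw0 hw1 hM0 (hbM n) hCΦ hsmall (hΦ w hww₁ (B n) (hB n) _ _) hn
    rw [jbDiff_succ]
    exact h
  have hpos : ∀ n, 0 < jbDiff w B n := by
    intro n
    induction n with
    | zero => rw [jbDiff_zero]; exact ahTheta_pos hw0
    | succ n ih => exact (hstep n ih).1
  refine ⟨hpos, fun n => ?_⟩
  induction n with
  | zero => simp [jbDiff_zero]
  | succ n ih =>
    have h := (hstep n (hpos n)).2
    rw [Finset.sum_range_succ, Nat.cast_succ]
    calc |Real.log (jbDiff w B (n + 1)) - Real.log (ahTheta w) -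
          (∑ j ∈ Finset.range n, jbGN w (ahPhase w (ahTheta w) B j) (ahPhase w 0 B j) * B j +
            jbGN w (ahPhase w (ahTheta w) B n) (ahPhase w 0 B n) * B n)|
        = |(Real.log (jbDiff w B n) - Real.log (ahTheta w) -
            ∑ j ∈ Finset.range n, jbGN w (ahPhase w (ahTheta w) B j) (ahPhase w 0 B j) * B j) +
          (Real.log (jbDiff w B (n + 1)) - Real.log (jbDiff w B n) -
            jbGN w (ahPhase w (ahTheta w) B n) (ahPhase w 0 B n) * B n)| := by ring_nf
      _ ≤ _ := abs_add_le _ _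
      _ ≤ (2 * C₁ ^ 2 + CΦ) * w ^ 2 * n + (2 * C₁ ^ 2 + CΦ) * w ^ 2 := add_le_add ih h
      _ = (2 * C₁ ^ 2 + CΦ) * w ^ 2 * (n + 1) := by ring

/-- **Lemma 3.7, (3.26): `Γ^0_n / Γ^ϑ_n = e^{K_n + 𝒪(w + w²n)}`** (one-sided form used by Lemma 6.1 / (6.9)):
there are `w₀ ∈ (0,1]`, `C₄ ≥ 0` with `Γ^ϑ_n, Γ^0_n > 0` and
`log Γ^0_n - log Γ^ϑ_n ≤ ∑_{j<n} w(s(X^0_j) - s(X^ϑ_j))B_{j+1} + C₄(w²n + w)` for `0 < w ≤ w₀`,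
`B ∈ [b₋,b₊]^ℕ`, all `n` (from the per-factor expansion (3.19), `|r| ≤ π²/2`, `s(0) = 0`).
[cite: AjankiHuveneers2011, Lemma 3.7 eq. (3.26) with (3.29), and its proof] -/
theorem jb_gamma_ratio (bm bp : ℝ) :
    ∃ w₀ : ℝ, 0 < w₀ ∧ w₀ ≤ 1 ∧ ∃ C₄ : ℝ, 0 ≤ C₄ ∧ ∀ w ∈ Set.Ioc 0 w₀, ∀ B : ℕ → ℝ,
      (∀ k, B k ∈ Set.Icc bm bp) → ∀ n,
        0 < ahGamma w (ahTheta w) B n ∧ 0 < ahGamma w 0 B n ∧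
        Real.log (ahGamma w 0 B n) - Real.log (ahGamma w (ahTheta w) B n) ≤
          ∑ j ∈ Finset.range n, w * (ahS (ahPhase w 0 B j) - ahS (ahPhase w (ahTheta w) B j)) * B j +
            C₄ * (w ^ 2 * n + w) := by
  obtain ⟨w₁, hw₁, CF, hCF0, hF⟩ := log_ahFactor_expansion bm bp
  obtain ⟨M, hM⟩ : ∃ M : ℝ, M = max |bm| |bp| := ⟨_, rfl⟩
  have hM0 : 0 ≤ M := hM ▸ le_max_of_le_left (abs_nonneg _)
  have hπ := Real.pi_pos
  refine ⟨min w₁ 1, by positivity, min_le_right _ _, π ^ 2 * M ^ 2 + 2 * CF + π * M, by positivity, ?_⟩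
  intro w hw B hB n
  obtain ⟨hw0, hwle⟩ := hw
  have hww₁ : w ∈ Set.Ioc 0 w₁ := ⟨hw0, hwle.trans (min_le_left _ _)⟩
  have hw1 : w ≤ 1 := hwle.trans (min_le_right _ _)
  have hbM : ∀ k, |B k| ≤ M := fun k => hM ▸ ReducedLawHyp.abs_le_of_mem (hB k)
  -- `|r| ≤ π²/2`
  have habsR : ∀ z : ℝ, |ahR z| ≤ π ^ 2 / 2 := by
    intro z
    unfold ahR
    have hc := Real.abs_cos_le_one (2 * π * z)
    have hc2 : |Real.cos (2 * π * z) ^ 2 - Real.cos (2 * π * z)| ≤ 2 := by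
      have := abs_le.mp hc
      rw [abs_le]; constructor <;> nlinarith
    rw [abs_mul, abs_of_pos (by positivity : (0:ℝ) < π ^ 2 / 4)]
    nlinarith [sq_nonneg π]
  set X := fun j => ahPhase w (ahTheta w) B j with hX
  set Y := fun j => ahPhase w 0 B j with hY
  have hfX : ∀ l, 0 < ahFactor w (X l) (B l) ∧
      |Real.log (ahFactor w (X l) (B l)) - (w * ahS (X l) * B l + w ^ 2 * ahR (X l) * B l ^ 2)| ≤ CF * w ^ 3 :=
    fun l => hF w hww₁ (X l) (B l) (hB l)
  have hfY : ∀ l, 0 < ahFactor w (Y l) (B l) ∧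
      |Real.log (ahFactor w (Y l) (B l)) - (w * ahS (Y l) * B l + w ^ 2 * ahR (Y l) * B l ^ 2)| ≤ CF * w ^ 3 :=
    fun l => hF w hww₁ (Y l) (B l) (hB l)
  have hposX : 0 < ahGamma w (ahTheta w) B n := Finset.prod_pos fun l _ => (hfX l).1
  have hposY : 0 < ahGamma w 0 B n := Finset.prod_pos fun l _ => (hfY l).1
  refine ⟨hposX, hposY, ?_⟩
  -- per-factor comparison
  have hterm : ∀ l, Real.log (ahFactor w (Y l) (B l)) - Real.log (ahFactor w (X l) (B l)) ≤
      w * (ahS (Y l) - ahS (X l)) * B l + (π ^ 2 * M ^ 2 + 2 * CF) * w ^ 2 := by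
    intro l
    have h1 := (abs_le.mp (hfX l).2).1
    have h2 := (abs_le.mp (hfY l).2).2
    have hr : |w ^ 2 * ahR (Y l) * B l ^ 2 - w ^ 2 * ahR (X l) * B l ^ 2| ≤ π ^ 2 * M ^ 2 * w ^ 2 := by
      rw [show w ^ 2 * ahR (Y l) * B l ^ 2 - w ^ 2 * ahR (X l) * B l ^ 2 =
        w ^ 2 * B l ^ 2 * (ahR (Y l) - ahR (X l)) by ring, abs_mul, abs_mul, abs_of_nonneg (sq_nonneg w),
        abs_of_nonneg (sq_nonneg (B l))]
      have hB2 : B l ^ 2 ≤ M ^ 2 := by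
        rw [← sq_abs (B l)]; exact pow_le_pow_left₀ (abs_nonneg _) (hbM l) 2
      have hRR : |ahR (Y l) - ahR (X l)| ≤ π ^ 2 := by
        calc |ahR (Y l) - ahR (X l)| ≤ |ahR (Y l)| + |ahR (X l)| := abs_sub _ _
          _ ≤ π ^ 2 / 2 + π ^ 2 / 2 := add_le_add (habsR _) (habsR _)
          _ = π ^ 2 := by ring
      calc w ^ 2 * B l ^ 2 * |ahR (Y l) - ahR (X l)| ≤ w ^ 2 * M ^ 2 * π ^ 2 := by gcongr
        _ = π ^ 2 * M ^ 2 * w ^ 2 := by ring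
    have hr' := (abs_le.mp hr).2
    have hw3 : CF * w ^ 3 ≤ CF * w ^ 2 := by
      have : w ^ 3 ≤ w ^ 2 := by nlinarith [sq_nonneg w]
      exact mul_le_mul_of_nonneg_left this hCF0
    nlinarith
  -- sum over the factors `l = 1, …, n-1`
  have hsumIco : Real.log (ahGamma w 0 B n) - Real.log (ahGamma w (ahTheta w) B n) ≤
      ∑ l ∈ Finset.Ico 1 n, w * (ahS (Y l) - ahS (X l)) * B l + (π ^ 2 * M ^ 2 + 2 * CF) * w ^ 2 * n := by
    rw [ahGamma, ahGamma, Real.log_prod (fun l _ => (hfY l).1.ne'), Real.log_prod (fun l _ => (hfX l).1.ne'),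
      ← Finset.sum_sub_distrib]
    calc ∑ l ∈ Finset.Ico 1 n, (Real.log (ahFactor w (Y l) (B l)) - Real.log (ahFactor w (X l) (B l)))
        ≤ ∑ l ∈ Finset.Ico 1 n, (w * (ahS (Y l) - ahS (X l)) * B l + (π ^ 2 * M ^ 2 + 2 * CF) * w ^ 2) :=
          Finset.sum_le_sum fun l _ => hterm l
      _ = ∑ l ∈ Finset.Ico 1 n, w * (ahS (Y l) - ahS (X l)) * B l +
            ((n - 1 : ℕ) : ℝ) * ((π ^ 2 * M ^ 2 + 2 * CF) * w ^ 2) := by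
          rw [Finset.sum_add_distrib, Finset.sum_const, Nat.card_Ico, nsmul_eq_mul]
      _ ≤ ∑ l ∈ Finset.Ico 1 n, w * (ahS (Y l) - ahS (X l)) * B l + (n : ℝ) * ((π ^ 2 * M ^ 2 + 2 * CF) * w ^ 2) := by
          have hn1 : ((n - 1 : ℕ) : ℝ) ≤ (n : ℝ) := by exact_mod_cast Nat.sub_le n 1
          have hK : 0 ≤ (π ^ 2 * M ^ 2 + 2 * CF) * w ^ 2 := by positivity
          nlinarith [mul_le_mul_of_nonneg_right hn1 hK]
      _ = _ := by ring
  -- the term `l = 0`: `X_0 = ϑ`, `Y_0 = 0`, `s(0) = 0`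
  have hzero : ∑ l ∈ Finset.Ico 1 n, w * (ahS (Y l) - ahS (X l)) * B l ≤
      ∑ l ∈ Finset.range n, w * (ahS (Y l) - ahS (X l)) * B l + π * M * w := by
    rcases Nat.eq_zero_or_pos n with hn | hn
    · subst hn; simp; positivity
    · rw [Finset.range_eq_Ico, Finset.sum_eq_sum_Ico_succ_bot hn]
      have h0 : |w * (ahS (Y 0) - ahS (X 0)) * B 0| ≤ π * M * w := by
        have hs : |ahS (Y 0) - ahS (X 0)| ≤ π := by
          have e1 : |ahS (Y 0)| ≤ π / 2 := by
            unfold ahS; rw [abs_mul, abs_neg, abs_of_pos (by positivity : (0:ℝ) < π / 2)]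
            nlinarith [Real.abs_sin_le_one (2 * π * Y 0), hπ]
          have e2 : |ahS (X 0)| ≤ π / 2 := by
            unfold ahS; rw [abs_mul, abs_neg, abs_of_pos (by positivity : (0:ℝ) < π / 2)]
            nlinarith [Real.abs_sin_le_one (2 * π * X 0), hπ]
          calc |ahS (Y 0) - ahS (X 0)| ≤ |ahS (Y 0)| + |ahS (X 0)| := abs_sub _ _
            _ ≤ π / 2 + π / 2 := add_le_add e1 e2
            _ = π := by ring
        rw [abs_mul, abs_mul, abs_of_pos hw0]
        calc w * |ahS (Y 0) - ahS (X 0)| * |B 0| ≤ w * π * M :=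
              mul_le_mul (mul_le_mul_of_nonneg_left hs hw0.le) (hbM 0) (abs_nonneg _) (by positivity)
          _ = π * M * w := by ring
      have := (abs_le.mp h0).1
      linarith
  have hwM : π * M * w ≤ π * M * w := le_rfl
  calc Real.log (ahGamma w 0 B n) - Real.log (ahGamma w (ahTheta w) B n)
      ≤ ∑ l ∈ Finset.Ico 1 n, w * (ahS (Y l) - ahS (X l)) * B l + (π ^ 2 * M ^ 2 + 2 * CF) * w ^ 2 * n := hsumIco
    _ ≤ (∑ l ∈ Finset.range n, w * (ahS (Y l) - ahS (X l)) * B l + π * M * w) +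
        (π ^ 2 * M ^ 2 + 2 * CF) * w ^ 2 * n := by linarith
    _ ≤ ∑ j ∈ Finset.range n, w * (ahS (ahPhase w 0 B j) - ahS (ahPhase w (ahTheta w) B j)) * B j +
        (π ^ 2 * M ^ 2 + 2 * CF + π * M) * (w ^ 2 * n + w) := by
        have h1 : 0 ≤ (π ^ 2 * M ^ 2 + 2 * CF) * w := by positivity
        have h2 : 0 ≤ π * M * (w ^ 2 * n) := by positivity
        simp only [hX, hY]
        nlinarith

/-! ### Azuma's bound and inequality (Lemmas 4.2–4.3) for predictable-coefficient sums on `τ^{⊗n}` -/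

/-- The predictable-coefficient sum `S_m = ∑_{j<m} g(X^x_j, X^y_j) B_{j+1}` over the pair of lifted chains
driven by the same disorder (the martingales `M`, `L`, `K` of Lemma 3.7 and their truncations are of
this form). [cite: AjankiHuveneers2011, Lemma 3.7 eqs. (3.28)-(3.29) and Lemma 6.1 (proof, "`R_n`")] -/
def jbSum (w : ℝ) (g : ℝ → ℝ → ℝ) (x y : ℝ) (B : ℕ → ℝ) (m : ℕ) : ℝ :=
  ∑ j ∈ Finset.range m, g (ahPhase w x B j) (ahPhase w y B j) * B j

/-- Markov property: splitting off the first mass, `S_{m+1}(b :: B) = g(x,y) b + S_m(B)` from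
`(f_b(x), f_b(y))`. [cite: AjankiHuveneers2011, Def. 3.3 eq. (3.12)] -/
theorem jbSum_cons (w : ℝ) (g : ℝ → ℝ → ℝ) (x y b : ℝ) {n : ℕ} (B : Fin n → ℝ) (m : ℕ) :
    jbSum w g x y (finExt (Fin.cons b B : Fin (n + 1) → ℝ)) (m + 1) =
      g x y * b + jbSum w g (ahStep w b x) (ahStep w b y) (finExt B) m := by
  unfold jbSum
  rw [Finset.sum_range_succ']
  simp only [ahPhase_finExt_cons, finExt_cons_zero, finExt_cons_succ, ahPhase_zero]
  ring

/-- `S_m` is measurable in the disorder. [folklore] -/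
theorem measurable_jbSum {g : ℝ → ℝ → ℝ} (hg : Measurable fun p : ℝ × ℝ => g p.1 p.2) (w x y : ℝ)
    {n : ℕ} (m : ℕ) : Measurable fun B : Fin n → ℝ => jbSum w g x y (finExt B) m := by
  unfold jbSum
  refine Finset.measurable_sum _ fun j _ => ?_
  exact (hg.comp ((measurable_ahPhase_pi w x j).prodMk (measurable_ahPhase_pi w y j))).mul
    (measurable_finExt j)

/-- **Hoeffding-type bound for one reduced mass**: `∫ e^{sb} τ(b) db ≤ e^{2s²b_*²}` for `|s| b_* ≤ 1/2`,
`b_* = max(|b₋|,|b₊|)` (`e^t ≤ (1+t)e^{2t²}` for `|t| ≤ 1/2`, `𝔼B = 0`). [cite: AjankiHuveneers2011, Lemma 4.2 (Azuma's bound, proof in App. 7.2)] -/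
theorem jb_mgf_le {τ : ℝ → ℝ} {bm bp : ℝ} (hτ : ReducedLawHyp τ bm bp) (ρB : Measure ℝ)
    (hρ : ρB = volume.withDensity fun s => ENNReal.ofReal (τ s)) {s : ℝ}
    (hs : |s| * max |bm| |bp| ≤ 1 / 2) :
    ∫⁻ b, ENNReal.ofReal (Real.exp (s * b)) ∂ρB ≤
      ENNReal.ofReal (Real.exp (2 * s ^ 2 * (max |bm| |bp|) ^ 2)) := by
  set M := max |bm| |bp| with hM
  have hM0 : 0 ≤ M := le_max_of_le_left (abs_nonneg _)
  set K := Real.exp (2 * s ^ 2 * M ^ 2) with hK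
  have hK0 : 0 < K := Real.exp_pos _
  have hτm : AEMeasurable (fun s => ENNReal.ofReal (τ s)) volume :=
    (hτ.integrable).aemeasurable.ennreal_ofReal
  have hpw : ∀ b, τ b * Real.exp (s * b) ≤ τ b * ((1 + s * b) * K) ∧ 0 ≤ τ b * ((1 + s * b) * K) := by
    intro b
    by_cases hb : b ∈ Set.Icc bm bp
    · have hbM : |b| ≤ M := ReducedLawHyp.abs_le_of_mem hb
      have hsb : |s * b| ≤ 1 / 2 := by
        rw [abs_mul]
        calc |s| * |b| ≤ |s| * M := mul_le_mul_of_nonneg_left hbM (abs_nonneg _)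
          _ ≤ 1 / 2 := hs
      have h1 := exp_le_one_add_mul_exp hsb
      have h2 : Real.exp (2 * (s * b) ^ 2) ≤ K := by
        rw [hK, Real.exp_le_exp, mul_pow]
        have : b ^ 2 ≤ M ^ 2 := by
          rw [← sq_abs b]; exact pow_le_pow_left₀ (abs_nonneg _) hbM 2
        nlinarith [sq_nonneg s]
      have h3 : 0 ≤ 1 + s * b := by linarith [(abs_le.mp hsb).1]
      exact ⟨mul_le_mul_of_nonneg_left (h1.trans (mul_le_mul_of_nonneg_left h2 h3)) (hτ.nonneg b),
        mul_nonneg (hτ.nonneg b) (mul_nonneg h3 hK0.le)⟩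
    · rw [hτ.eq_zero b hb, zero_mul, zero_mul]
      exact ⟨le_rfl, le_rfl⟩
  have hint : Integrable fun b => τ b * ((1 + s * b) * K) := by
    have h := ((hτ.integrable.const_mul 1).add (hτ.integrable_id_mul.const_mul s)).mul_const K
    refine h.congr (ae_of_all _ fun b => ?_)
    simp only [Pi.add_apply]
    ring
  calc ∫⁻ b, ENNReal.ofReal (Real.exp (s * b)) ∂ρB
      = ∫⁻ b, ENNReal.ofReal (τ b) * ENNReal.ofReal (Real.exp (s * b)) ∂volume := by
        rw [hρ, lintegral_withDensity_eq_lintegral_mul_non_measurable₀ _ hτm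
          (ae_of_all _ fun s => ENNReal.ofReal_lt_top)]
        rfl
    _ = ∫⁻ b, ENNReal.ofReal (τ b * Real.exp (s * b)) ∂volume := by
        refine lintegral_congr fun b => ?_
        rw [ENNReal.ofReal_mul (hτ.nonneg b)]
    _ ≤ ∫⁻ b, ENNReal.ofReal (τ b * ((1 + s * b) * K)) ∂volume :=
        lintegral_mono fun b => ENNReal.ofReal_le_ofReal (hpw b).1
    _ = ENNReal.ofReal (∫ b, τ b * ((1 + s * b) * K) ∂volume) :=
        (ofReal_integral_eq_lintegral_ofReal hint (ae_of_all _ fun b => (hpw b).2)).symm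
    _ = ENNReal.ofReal K := by
        congr 1
        have : (fun b => τ b * ((1 + s * b) * K)) = fun b => K * ((1 + s * b) * τ b) := by
          funext b; ring
        rw [this, integral_const_mul, hτ.integral_affine]
        ring

/-- **Azuma's bound (Lemma 4.2) for the pair chain**: for a Borel coefficient `|g| ≤ c` and `|t| c b_* ≤ 1/2`,
`𝔼 exp(t ∑_{j<m} g(X^x_j, X^y_j)B_{j+1}) ≤ (e^{2t²c²b_*²})^m` over `(B_1,…,B_n) ∼ τ^{⊗n}`, `m ≤ n`,
uniformly in the starting points (induction on `m`, splitting off the first mass; the paper's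
"`𝔼 e^{tM_n} ≤ e^{(t²/2)m²n}`" up to the constant in the exponent).
[cite: AjankiHuveneers2011, Lemma 4.2 ("Azuma's bound"), proof in App. 7.2] -/
theorem jb_lintegral_exp_jbSum_le {τ : ℝ → ℝ} {bm bp : ℝ} (hτ : ReducedLawHyp τ bm bp)
    (ρB : Measure ℝ) [IsProbabilityMeasure ρB]
    (hρ : ρB = volume.withDensity fun s => ENNReal.ofReal (τ s)) {g : ℝ → ℝ → ℝ}
    (hg : Measurable fun p : ℝ × ℝ => g p.1 p.2) {c : ℝ} (hc0 : 0 ≤ c) (hc : ∀ x y, |g x y| ≤ c)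
    {t : ℝ} (ht : |t| * c * max |bm| |bp| ≤ 1 / 2) (w : ℝ) :
    ∀ m n : ℕ, m ≤ n → ∀ x y : ℝ,
      ∫⁻ B : Fin n → ℝ, ENNReal.ofReal (Real.exp (t * jbSum w g x y (finExt B) m))
          ∂(Measure.pi fun _ : Fin n => ρB) ≤
        ENNReal.ofReal (Real.exp (2 * (t * c) ^ 2 * (max |bm| |bp|) ^ 2) ^ m) := by
  set M := max |bm| |bp| with hM
  have hM0 : 0 ≤ M := le_max_of_le_left (abs_nonneg _)
  set R := Real.exp (2 * (t * c) ^ 2 * M ^ 2) with hR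
  have hR0 : 0 < R := Real.exp_pos _
  intro m
  induction m with
  | zero =>
    intro n _ x y
    simp [jbSum]
  | succ m ih =>
    intro n hmn x y
    obtain ⟨n, rfl⟩ : ∃ n', n = n' + 1 := ⟨n - 1, by omega⟩
    have hmn' : m ≤ n := by omega
    set F : (Fin (n + 1) → ℝ) → ℝ≥0∞ := fun B =>
      ENNReal.ofReal (Real.exp (t * jbSum w g x y (finExt B) (m + 1))) with hF
    have hFm : Measurable F :=
      ENNReal.measurable_ofReal.comp (Real.measurable_exp.comp
        (measurable_const.mul (measurable_jbSum hg w x y (m + 1))))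
    have hcons : ∀ (b : ℝ) (B' : Fin n → ℝ), F (Fin.cons b B') =
        ENNReal.ofReal (Real.exp (t * g x y * b)) *
          ENNReal.ofReal (Real.exp (t * jbSum w g (ahStep w b x) (ahStep w b y) (finExt B') m)) := by
      intro b B'
      rw [hF]
      dsimp only
      rw [jbSum_cons, mul_add, Real.exp_add, ENNReal.ofReal_mul (Real.exp_pos _).le]
      ring_nf
    -- one-variable bound with `s = t g(x,y)`
    have hs : |t * g x y| * M ≤ 1 / 2 := by
      rw [abs_mul]
      calc |t| * |g x y| * M ≤ |t| * c * M := by gcongr; exact hc x y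
        _ ≤ 1 / 2 := ht
    have hone : ∫⁻ b, ENNReal.ofReal (Real.exp (t * g x y * b)) ∂ρB ≤ ENNReal.ofReal R := by
      refine (jb_mgf_le hτ ρB hρ hs).trans (ENNReal.ofReal_le_ofReal ?_)
      rw [hR, Real.exp_le_exp]
      have h1 : (t * g x y) ^ 2 ≤ (t * c) ^ 2 := by
        rw [← sq_abs (t * g x y), ← sq_abs (t * c), abs_mul, abs_mul, abs_of_nonneg hc0]
        exact pow_le_pow_left₀ (by positivity) (mul_le_mul_of_nonneg_left (hc x y) (abs_nonneg t)) 2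
      nlinarith [sq_nonneg M]
    rw [ig_lintegral_pi_succ ρB n hFm]
    calc ∫⁻ b, ∫⁻ B', F (Fin.cons b B') ∂(Measure.pi fun _ : Fin n => ρB) ∂ρB
        = ∫⁻ b, ENNReal.ofReal (Real.exp (t * g x y * b)) *
            ∫⁻ B', ENNReal.ofReal (Real.exp (t * jbSum w g (ahStep w b x) (ahStep w b y) (finExt B') m))
              ∂(Measure.pi fun _ : Fin n => ρB) ∂ρB := by
          refine lintegral_congr fun b => ?_
          rw [← lintegral_const_mul' _ _ ENNReal.ofReal_ne_top]
          exact lintegral_congr fun B' => hcons b B'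
      _ ≤ ∫⁻ b, ENNReal.ofReal (Real.exp (t * g x y * b)) * ENNReal.ofReal (R ^ m) ∂ρB :=
          lintegral_mono fun b => mul_le_mul' le_rfl (ih n hmn' _ _)
      _ = ENNReal.ofReal (R ^ m) * ∫⁻ b, ENNReal.ofReal (Real.exp (t * g x y * b)) ∂ρB := by
          rw [← lintegral_const_mul' _ _ ENNReal.ofReal_ne_top]
          exact lintegral_congr fun b => mul_comm _ _
      _ ≤ ENNReal.ofReal (R ^ m) * ENNReal.ofReal R := mul_le_mul' le_rfl hone
      _ = ENNReal.ofReal (R ^ (m + 1)) := by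
          rw [← ENNReal.ofReal_mul (pow_nonneg hR0.le m), pow_succ]

/-- **Azuma's inequality (Lemma 4.3) for the pair chain, one-sided**: for a Borel coefficient `|g| ≤ c`,
`0 ≤ t`, `t c b_* ≤ 1/2` and `m ≤ n`,
`P(∑_{j<m} g(X^x_j, X^y_j) B_{j+1} ≥ r) ≤ exp(-tr + 2 m t²c²b_*²)` under `τ^{⊗n}` (Markov's inequality on
the exponential moment). [cite: AjankiHuveneers2011, Lemma 4.3 ("Azuma's inequality")] -/
theorem jb_azuma_tail {τ : ℝ → ℝ} {bm bp : ℝ} (hτ : ReducedLawHyp τ bm bp)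
    (ρB : Measure ℝ) [IsProbabilityMeasure ρB]
    (hρ : ρB = volume.withDensity fun s => ENNReal.ofReal (τ s)) {g : ℝ → ℝ → ℝ}
    (hg : Measurable fun p : ℝ × ℝ => g p.1 p.2) {c : ℝ} (hc0 : 0 ≤ c) (hc : ∀ x y, |g x y| ≤ c)
    {t : ℝ} (ht0 : 0 ≤ t) (ht : t * c * max |bm| |bp| ≤ 1 / 2) (w x y : ℝ) {m n : ℕ} (hmn : m ≤ n)
    (r : ℝ) :
    (Measure.pi fun _ : Fin n => ρB).real {B | r ≤ jbSum w g x y (finExt B) m} ≤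
      Real.exp (-(t * r) + m * (2 * (t * c) ^ 2 * (max |bm| |bp|) ^ 2)) := by
  set μ : Measure (Fin n → ℝ) := Measure.pi fun _ : Fin n => ρB with hμ
  set R := Real.exp (2 * (t * c) ^ 2 * (max |bm| |bp|) ^ 2) with hR
  have hR0 : 0 < R := Real.exp_pos _
  have ht' : |t| * c * max |bm| |bp| ≤ 1 / 2 := by rwa [abs_of_nonneg ht0]
  have hmom := jb_lintegral_exp_jbSum_le hτ ρB hρ hg hc0 hc ht' w m n hmn x y
  set F : (Fin n → ℝ) → ℝ≥0∞ := fun B => ENNReal.ofReal (Real.exp (t * jbSum w g x y (finExt B) m)) with hF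
  have hFm : Measurable F :=
    ENNReal.measurable_ofReal.comp (Real.measurable_exp.comp
      (measurable_const.mul (measurable_jbSum hg w x y m)))
  set ε : ℝ≥0∞ := ENNReal.ofReal (Real.exp (t * r)) with hε
  have hε0 : ε ≠ 0 := by rw [hε]; exact (ENNReal.ofReal_pos.mpr (Real.exp_pos _)).ne'
  have hεtop : ε ≠ ∞ := ENNReal.ofReal_ne_top
  have hsub : {B : Fin n → ℝ | r ≤ jbSum w g x y (finExt B) m} ⊆ {B | ε ≤ F B} := by
    intro B hB
    simp only [Set.mem_setOf_eq] at hB ⊢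
    rw [hε, hF]
    exact ENNReal.ofReal_le_ofReal (Real.exp_le_exp.mpr (mul_le_mul_of_nonneg_left hB ht0))
  have hmarkov : μ {B | ε ≤ F B} ≤ ENNReal.ofReal (R ^ m) / ε := by
    rw [ENNReal.le_div_iff_mul_le (Or.inl hε0) (Or.inl hεtop), mul_comm]
    exact (mul_meas_ge_le_lintegral hFm ε).trans hmom
  have hle : μ {B | r ≤ jbSum w g x y (finExt B) m} ≤ ENNReal.ofReal (R ^ m / Real.exp (t * r)) := by
    calc μ {B | r ≤ jbSum w g x y (finExt B) m} ≤ μ {B | ε ≤ F B} := measure_mono hsub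
      _ ≤ ENNReal.ofReal (R ^ m) / ε := hmarkov
      _ = ENNReal.ofReal (R ^ m / Real.exp (t * r)) := by
          rw [hε, ENNReal.ofReal_div_of_pos (Real.exp_pos _)]
  calc μ.real {B | r ≤ jbSum w g x y (finExt B) m}
      = (μ {B | r ≤ jbSum w g x y (finExt B) m}).toReal := rfl
    _ ≤ (ENNReal.ofReal (R ^ m / Real.exp (t * r))).toReal :=
        ENNReal.toReal_mono ENNReal.ofReal_ne_top hle
    _ = R ^ m / Real.exp (t * r) := ENNReal.toReal_ofReal (by positivity)
    _ = Real.exp (-(t * r) + m * (2 * (t * c) ^ 2 * (max |bm| |bp|) ^ 2)) := by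
        rw [hR, ← Real.exp_nat_mul, div_eq_mul_inv, ← Real.exp_neg, ← Real.exp_add]
        ring_nf

/-- From an a.e. inclusion `S ⊆ T ∪ ⋃_{j<n} bad_j` to the union bound on probabilities. [folklore] -/
theorem jb_measureReal_le_of_ae_subset {Ω : Type*} [MeasurableSpace Ω] (μ : Measure Ω) [IsFiniteMeasure μ]
    {S T : Set Ω} {n : ℕ} {bad : ℕ → Set Ω}
    (h : ∀ᵐ ω ∂μ, ω ∈ S → ω ∈ T ∨ ∃ j < n, ω ∈ bad j) :
    μ.real S ≤ μ.real T + ∑ j ∈ Finset.range n, μ.real (bad j) := by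
  have hincl : S ≤ᵐ[μ] (T ∪ ⋃ j ∈ Finset.range n, bad j : Set Ω) := by
    refine h.mono fun ω hω hS => ?_
    rcases hω hS with hT | ⟨j, hj, hb⟩
    · exact Or.inl hT
    · refine Or.inr ?_
      simp only [Set.mem_iUnion, Finset.mem_range]
      exact ⟨j, hj, hb⟩
  have h1 : μ S ≤ μ T + ∑ j ∈ Finset.range n, μ (bad j) :=
    calc μ S ≤ μ (T ∪ ⋃ j ∈ Finset.range n, bad j) := measure_mono_ae hincl
      _ ≤ μ T + μ (⋃ j ∈ Finset.range n, bad j) := measure_union_le _ _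
      _ ≤ μ T + ∑ j ∈ Finset.range n, μ (bad j) :=
          add_le_add le_rfl (measure_biUnion_finset_le _ _)
  simp only [measureReal_def]
  rw [← ENNReal.toReal_sum (fun j _ => measure_ne_top _ _), ← ENNReal.toReal_add (measure_ne_top _ _)
    (ENNReal.sum_ne_top.mpr fun j _ => measure_ne_top _ _)]
  exact ENNReal.toReal_mono (ENNReal.add_ne_top.mpr ⟨measure_ne_top _ _,
    ENNReal.sum_ne_top.mpr fun j _ => measure_ne_top _ _⟩) h1

/-! ### Real-variable bookkeeping for Lemma 6.1 -/

/-- `e^{-κ/w} ≤ w^α` for `0 < w ≤ (κ/2α)²`. [folklore] -/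
theorem jb_exp_neg_inv_le_rpow {κ α w : ℝ} (hκ : 0 < κ) (hα : 0 < α) (hw0 : 0 < w)
    (hwa : w ≤ (κ / (2 * α)) ^ 2) : Real.exp (-(κ / w)) ≤ w ^ α := by
  rw [Real.rpow_def_of_pos hw0, Real.exp_le_exp]
  set s := Real.sqrt w with hs
  have hs0 : 0 < s := Real.sqrt_pos.mpr hw0
  have hsw : s ^ 2 = w := Real.sq_sqrt hw0.le
  have hlog : -(2 / s) ≤ Real.log w := by
    have h1 := Real.log_le_sub_one_of_pos (inv_pos.mpr hs0)
    rw [Real.log_inv] at h1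
    have h2 : Real.log w = 2 * Real.log s := by
      rw [← hsw, Real.log_pow]; norm_num
    rw [h2, div_eq_mul_inv]
    have : 0 < s⁻¹ := inv_pos.mpr hs0
    linarith
  have hsle : s ≤ κ / (2 * α) := by
    calc s ≤ Real.sqrt ((κ / (2 * α)) ^ 2) := Real.sqrt_le_sqrt hwa
      _ = κ / (2 * α) := Real.sqrt_sq (by positivity)
  have h3 : 2 * α * s ≤ κ := by rwa [le_div_iff₀ (by positivity), mul_comm] at hsle
  have h4 : 2 * α / s ≤ κ / w := by
    rw [div_le_div_iff₀ hs0 hw0, ← hsw]; nlinarith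
  calc -(κ / w) ≤ -(2 * α / s) := by linarith
    _ = -(2 / s) * α := by ring
    _ ≤ Real.log w * α := mul_le_mul_of_nonneg_right hlog hα.le

/-- `n e^{-κ log²w} ≤ w^α` for `w²n ≤ 1` and `0 < w ≤ e^{-(α+2)/κ}`. [folklore] -/
theorem jb_nat_mul_exp_neg_log_sq_le_rpow {κ α w : ℝ} {n : ℕ} (hκ : 0 < κ) (hα : 0 < α) (hw0 : 0 < w)
    (hwb : w ≤ Real.exp (-((α + 2) / κ))) (hwn : w ^ 2 * n ≤ 1) :
    (n : ℝ) * Real.exp (-(κ * Real.log w ^ 2)) ≤ w ^ α := by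
  set L := -Real.log w with hL
  have hlogw : Real.log w ≤ -((α + 2) / κ) := by
    have := Real.log_le_log hw0 hwb; rwa [Real.log_exp] at this
  have hL1 : (α + 2) / κ ≤ L := by rw [hL]; linarith
  have hL0 : 0 ≤ L := le_trans (by positivity) hL1
  have hkey : (α + 2) * L ≤ κ * L ^ 2 := by
    have : α + 2 ≤ κ * L := by rw [div_le_iff₀ hκ] at hL1; linarith
    nlinarith
  have hn : (n : ℝ) ≤ Real.exp (2 * L) := by
    have h1 : (n : ℝ) ≤ 1 / w ^ 2 := by rw [le_div_iff₀ (by positivity)]; linarith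
    have h2 : Real.exp (2 * L) = 1 / w ^ 2 := by
      have e1 : 2 * L = -Real.log (w ^ 2) := by rw [hL, Real.log_pow]; push_cast; ring
      rw [e1, Real.exp_neg, Real.exp_log (by positivity), one_div]
    linarith
  rw [Real.rpow_def_of_pos hw0]
  calc (n : ℝ) * Real.exp (-(κ * Real.log w ^ 2)) ≤ Real.exp (2 * L) * Real.exp (-(κ * Real.log w ^ 2)) :=
        mul_le_mul_of_nonneg_right hn (Real.exp_pos _).le
    _ = Real.exp (2 * L - κ * L ^ 2) := by rw [← Real.exp_add, hL]; ring_nf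
    _ ≤ Real.exp (Real.log w * α) := by rw [Real.exp_le_exp, hL]; nlinarith

/-- The exponent of Azuma's inequality for the truncated martingales `L̃`, `K̃` (coefficients `≲ w^{3/2}`,
`t = 1/(2Aw)`): `-t + n·2t²(Pw³) ≤ -1/(4Aw)` when `2P ≤ A`, `w²n ≤ 1`. [cite: AjankiHuveneers2011, Lemma 6.1 eq. (6.5)] -/
theorem jb_exponent_trunc {A P w n : ℝ} (hA : 0 < A) (hP : 0 ≤ P) (hPA : 2 * P ≤ A) (hw0 : 0 < w)
    (hwn : w ^ 2 * n ≤ 1) :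
    -(1 / (2 * A * w) * 1) + n * (2 * (1 / (2 * A * w)) ^ 2 * (P * w ^ 3)) ≤ -(1 / (4 * A) / w) := by
  have h1 : n * (2 * (1 / (2 * A * w)) ^ 2 * (P * w ^ 3)) = P * (w ^ 2 * n) / (2 * A ^ 2 * w) := by
    rw [eq_div_iff (by positivity)]
    field_simp
  have h2 : P * (w ^ 2 * n) / (2 * A ^ 2 * w) ≤ P * 1 / (2 * A ^ 2 * w) := by
    gcongr
  have h3 : P * 1 / (2 * A ^ 2 * w) ≤ 1 / (4 * A * w) := by
    rw [div_le_div_iff₀ (by positivity) (by positivity)]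
    nlinarith [mul_pos hA hw0]
  have h4 : -(1 / (2 * A * w) * 1) + 1 / (4 * A * w) = -(1 / (4 * A) / w) := by
    field_simp; ring
  linarith

/-- The exponent of Azuma's inequality for the size of `A_j = e^{M_j + L_j + 𝒪(w²j)}` (coefficients `≲ w`,
`t = L/(8A)`, level `L/4`, `L = log(1/w)`): `≤ -L²/(64A)` when `2P ≤ A`, `w²j ≤ 1`.
[cite: AjankiHuveneers2011, Lemma 6.1 (proof, last display)] -/
theorem jb_exponent_size {A P L w j : ℝ} (hA : 0 < A) (hP : 0 ≤ P) (hPA : 2 * P ≤ A)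
    (hwj : w ^ 2 * j ≤ 1) :
    -(L / (8 * A) * (L / 4)) + j * (2 * (L / (8 * A)) ^ 2 * (P * w ^ 2)) ≤ -(1 / (64 * A) * L ^ 2) := by
  have h1 : j * (2 * (L / (8 * A)) ^ 2 * (P * w ^ 2)) = P * (w ^ 2 * j) * L ^ 2 / (32 * A ^ 2) := by
    rw [eq_div_iff (by positivity)]
    field_simp
    ring
  have h2 : P * (w ^ 2 * j) * L ^ 2 / (32 * A ^ 2) ≤ P * 1 * L ^ 2 / (32 * A ^ 2) := by
    gcongr
  have h3 : P * 1 * L ^ 2 / (32 * A ^ 2) ≤ L ^ 2 / (64 * A) := by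
    rw [div_le_div_iff₀ (by positivity) (by positivity)]
    nlinarith [sq_nonneg L, mul_nonneg (sq_nonneg L) hA.le]
  have h4 : -(L / (8 * A) * (L / 4)) + L ^ 2 / (64 * A) = -(1 / (64 * A) * L ^ 2) := by
    field_simp; ring
  linarith

/-- `w log(1/w) ≤ 1` (`0 < w`). [folklore] -/
theorem jb_mul_neg_log_le_one {w : ℝ} (hw0 : 0 < w) : w * -Real.log w ≤ 1 := by
  have h1 := Real.log_le_sub_one_of_pos (inv_pos.mpr hw0)
  rw [Real.log_inv] at h1
  have h2 : w * -Real.log w ≤ w * (w⁻¹ - 1) := mul_le_mul_of_nonneg_left h1 hw0.le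
  rw [mul_sub, mul_inv_cancel₀ hw0.ne'] at h2
  linarith

/-- The constant `A₁(b_*) = 18π⁴b_*² + 6π²b_* + 1` of the truncated-sum bound (`κ₀ = 1/(4A₁)`). [folklore] -/
def jbA₁ (M : ℝ) : ℝ := 18 * π ^ 4 * M ^ 2 + 6 * π ^ 2 * M + 1

/-- The constant `A₂(b_*) = 2π²b_*² + πb_* + 1` of the size bound (`κ₁ = 1/(64A₂)`). [folklore] -/
def jbA₂ (M : ℝ) : ℝ := 2 * π ^ 2 * M ^ 2 + π * M + 1

/-- `A₁ > 0`. [folklore] -/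
theorem jbA₁_pos {M : ℝ} (hM : 0 ≤ M) : 0 < jbA₁ M := by unfold jbA₁; positivity

/-- `A₂ > 0`. [folklore] -/
theorem jbA₂_pos {M : ℝ} (hM : 0 ≤ M) : 0 < jbA₂ M := by unfold jbA₂; positivity

/-- **(6.5): Azuma for the truncated sums.** For a Borel coefficient `|g| ≤ 3π²w√w`, `0 < w ≤ 1`,
`w²n ≤ 1`: `P(∑_{j<n} g(X^x_j,X^y_j)B_{j+1} ≥ 1) ≤ e^{-κ₀/w}`, `κ₀ = 1/(4A₁(b_*))` ("`P(w^{3/2}∑ w^{1/2}Ã S B ≥ a)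
≤ 2e^{-Ca²/w³n} ≤ e^{-Ca²w⁻¹}`"). [cite: AjankiHuveneers2011, Lemma 6.1 eq. (6.5)] -/
theorem jb_trunc_tail {τ : ℝ → ℝ} {bm bp : ℝ} (hτ : ReducedLawHyp τ bm bp)
    (ρB : Measure ℝ) [IsProbabilityMeasure ρB]
    (hρ : ρB = volume.withDensity fun s => ENNReal.ofReal (τ s)) {w : ℝ} (hw0 : 0 < w) (hw1 : w ≤ 1)
    {n : ℕ} (hwn : w ^ 2 * n ≤ 1) {g : ℝ → ℝ → ℝ} (hg : Measurable fun p : ℝ × ℝ => g p.1 p.2)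
    (hgb : ∀ x y, |g x y| ≤ 3 * π ^ 2 * w * Real.sqrt w) (x y : ℝ) :
    (Measure.pi fun _ : Fin n => ρB).real {B | 1 ≤ jbSum w g x y (finExt B) n} ≤
      Real.exp (-(1 / (4 * jbA₁ (max |bm| |bp|)) / w)) := by
  set M := max |bm| |bp| with hM
  have hM0 : 0 ≤ M := le_max_of_le_left (abs_nonneg _)
  have hπ := Real.pi_pos
  have hA := jbA₁_pos hM0
  set sw := Real.sqrt w with hsw
  have hsw0 : 0 ≤ sw := Real.sqrt_nonneg _
  have hsw2 : sw ^ 2 = w := Real.sq_sqrt hw0.le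
  have hsw1 : sw ≤ 1 := by rw [hsw, Real.sqrt_le_one]; exact hw1
  have hc0 : 0 ≤ 3 * π ^ 2 * w * sw := by positivity
  have ht0 : 0 ≤ 1 / (2 * jbA₁ M * w) := by positivity
  have ht : 1 / (2 * jbA₁ M * w) * (3 * π ^ 2 * w * sw) * max |bm| |bp| ≤ 1 / 2 := by
    rw [← hM]
    have h1 : 1 / (2 * jbA₁ M * w) * (3 * π ^ 2 * w * sw) * M = 3 * π ^ 2 * sw * M / (2 * jbA₁ M) := by
      field_simp
    rw [h1, div_le_iff₀ (by positivity)]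
    have h2 : 3 * π ^ 2 * sw * M ≤ 3 * π ^ 2 * 1 * M := by gcongr
    have h3 : 3 * π ^ 2 * 1 * M ≤ jbA₁ M := by
      unfold jbA₁
      have : 0 ≤ 18 * π ^ 4 * M ^ 2 + 3 * π ^ 2 * M + 1 := by positivity
      linarith
    linarith
  have h := jb_azuma_tail hτ ρB hρ hg hc0 hgb ht0 ht w x y (le_refl n) 1
  refine h.trans ?_
  rw [Real.exp_le_exp, ← hM]
  have hP : 2 * (1 / (2 * jbA₁ M * w) * (3 * π ^ 2 * w * sw)) ^ 2 * M ^ 2 =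
      2 * (1 / (2 * jbA₁ M * w)) ^ 2 * (9 * π ^ 4 * M ^ 2 * w ^ 3) := by
    rw [show w ^ 3 = w ^ 2 * sw ^ 2 by rw [hsw2]; ring]; ring
  rw [hP]
  have hPA : 2 * (9 * π ^ 4 * M ^ 2) ≤ jbA₁ M := by
    unfold jbA₁
    have : 0 ≤ 6 * π ^ 2 * M + 1 := by positivity
    linarith
  exact jb_exponent_trunc (P := 9 * π ^ 4 * M ^ 2) hA (by positivity) hPA hw0 hwn

/-- **Azuma for the size of `A_j`** (last display of the proof of Lemma 6.1): for `0 < w ≤ 1`, `j ≤ n`,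
`w²n ≤ 1`, `0 ≤ L`, `Lw ≤ 1`: `P(∑_{i<j} v(X^x_i,X^y_i)B_{i+1} ≥ L/4) ≤ e^{-κ₁L²}`, `κ₁ = 1/(64A₂(b_*))`
("`P(w∑G_{k-1}B_k + 𝒪(w²n) > ½log(1/w)) ≲ e^{-C log²(1/w)/((j-1)w²)} ≤ e^{-C' log²(1/w)}`").
[cite: AjankiHuveneers2011, Lemma 6.1 (proof, last display)] -/
theorem jb_size_tail {τ : ℝ → ℝ} {bm bp : ℝ} (hτ : ReducedLawHyp τ bm bp)
    (ρB : Measure ℝ) [IsProbabilityMeasure ρB]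
    (hρ : ρB = volume.withDensity fun s => ENNReal.ofReal (τ s)) {w : ℝ} (hw0 : 0 < w)
    {j n : ℕ} (hj : j ≤ n) (hwn : w ^ 2 * n ≤ 1) {L : ℝ} (hL0 : 0 ≤ L) (hLw : L * w ≤ 1) (x y : ℝ) :
    (Measure.pi fun _ : Fin n => ρB).real {B | L / 4 ≤ jbSum w (jbGN w) x y (finExt B) j} ≤
      Real.exp (-(1 / (64 * jbA₂ (max |bm| |bp|)) * L ^ 2)) := by
  set M := max |bm| |bp| with hM
  have hM0 : 0 ≤ M := le_max_of_le_left (abs_nonneg _)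
  have hπ := Real.pi_pos
  have hA := jbA₂_pos hM0
  have hc0 : 0 ≤ π * w := by positivity
  have ht0 : 0 ≤ L / (8 * jbA₂ M) := by positivity
  have ht : L / (8 * jbA₂ M) * (π * w) * max |bm| |bp| ≤ 1 / 2 := by
    rw [← hM]
    have h1 : L / (8 * jbA₂ M) * (π * w) * M = π * M * (L * w) / (8 * jbA₂ M) := by
      field_simp
    rw [h1, div_le_iff₀ (by positivity)]
    have h2 : π * M * (L * w) ≤ π * M * 1 := mul_le_mul_of_nonneg_left hLw (by positivity)
    have h3 : π * M * 1 ≤ jbA₂ M := by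
      unfold jbA₂
      have : 0 ≤ 2 * π ^ 2 * M ^ 2 + 1 := by positivity
      linarith
    linarith
  have h := jb_azuma_tail hτ ρB hρ (measurable_jbGN w) hc0 (abs_jbGN_le hw0.le) ht0 ht w x y hj (L / 4)
  refine h.trans ?_
  rw [Real.exp_le_exp, ← hM]
  have hwj : w ^ 2 * j ≤ 1 := by
    have : (j : ℝ) ≤ n := by exact_mod_cast hj
    nlinarith [sq_nonneg w]
  have hP : 2 * (L / (8 * jbA₂ M) * (π * w)) ^ 2 * M ^ 2 =
      2 * (L / (8 * jbA₂ M)) ^ 2 * (π ^ 2 * M ^ 2 * w ^ 2) := by ring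
  rw [hP]
  have hPA : 2 * (π ^ 2 * M ^ 2) ≤ jbA₂ M := by
    unfold jbA₂
    have : 0 ≤ π * M + 1 := by positivity
    linarith
  exact jb_exponent_size (P := π ^ 2 * M ^ 2) hA (by positivity) hPA hwj

end Literature.Barriers.AtomisticToContinuum.HeatConduction

namespace Literature.Barriers.AtomisticToContinuum

open Literature.MathematicalPhysics.KineticTheory.HeatConduction HeatConduction MeasureTheory Finset Real

set_option maxHeartbeats 800000 in
/-- **Lemma 3.7 + Lemma 6.1 discharged** (the tail form (6.8)–(6.9) in which §6.1 consumes them): for the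
reduced law `τ` and every `α > 0` there are `C = 2`, `c₀ = 2e^{1 + C₃ + 2C₄}`, `w₀ > 0` with
`P(e^{M_n} ≤ R, X^ϑ_n - X^0_n > c₀Rw) ≤ 2w^α` and `P(Γ^0_n > c₀Γ^ϑ_n) ≤ 2w^α` for `0 < w ≤ w₀`, `n ≥ 1`,
`w²n ≤ 1`, all `R`. Proof: the recursion of Lemma 3.7 for `d_n = X^ϑ_n - X^0_n` (`jb_theta_recursion`) and the
ratio of the amplitudes (`jb_gamma_ratio`) reduce both events, on `{max_{j<n} d_j ≤ √w}`, to
`{L̃_n ≥ 1}`, `{K̃_n ≥ 1}` for truncated predictable-coefficient sums with coefficients `≲ w^{3/2}`, whose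
probability is `≤ e^{-κ₀/w}` by Azuma's inequality (`jb_trunc_tail`), while
`P(d_j > √w) ≤ P(N_j ≥ ¼ log(1/w)) ≤ e^{-κ₁ log²(1/w)}` for each `j < n ≤ w⁻²` (`jb_size_tail`); finally
`e^{-κ₀/w} + n e^{-κ₁log²(1/w)} ≤ 2w^α` for `w ≤ w₀(α)`.
[cite: AjankiHuveneers2011, Lemma 3.7 eqs. (3.25)-(3.30), Lemma 6.1 eqs. (6.2)-(6.5), §6.1 eqs. (6.8)-(6.9)] -/
theorem AjankiHuveneers2011_jointBehaviourTails_holds : AjankiHuveneers2011_jointBehaviourTails := by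
  intro τ bm bp hτ ρB _ hρ α hα
  obtain ⟨w₁, hw₁, hw₁1, C₃, hC₃, hrec⟩ := jb_theta_recursion bm bp
  obtain ⟨w₂, hw₂, hw₂1, C₄, hC₄, hgam⟩ := jb_gamma_ratio bm bp
  have hπ := Real.pi_pos
  have hbm0 := hτ.bm_nonpos
  have hbp0 := hτ.bp_nonneg
  set M := max |bm| |bp| with hM
  have hM0 : 0 ≤ M := le_max_of_le_left (abs_nonneg _)
  set κ₀ : ℝ := 1 / (4 * jbA₁ M) with hκ₀
  set κ₁ : ℝ := 1 / (64 * jbA₂ M) with hκ₁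
  have hκ₀0 : 0 < κ₀ := by rw [hκ₀]; exact div_pos one_pos (mul_pos four_pos (jbA₁_pos hM0))
  have hκ₁0 : 0 < κ₁ := by rw [hκ₁]; exact div_pos one_pos (mul_pos (by norm_num) (jbA₂_pos hM0))
  set c₀ : ℝ := 2 * Real.exp (1 + C₃ + 2 * C₄) with hc₀
  have hc₀0 : 0 < c₀ := by positivity
  set wa : ℝ := (κ₀ / (2 * α)) ^ 2 with hwa
  set wb : ℝ := Real.exp (-((α + 2) / κ₁)) with hwb
  set wc : ℝ := Real.exp (-(4 * (Real.log 2 + C₃))) with hwc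
  set w₀ : ℝ := min (min (min w₁ w₂) (min wa wb)) (min wc (1 / 5)) with hw₀
  have hwa0 : 0 < wa := by rw [hwa]; positivity
  have hw₀0 : 0 < w₀ := by
    rw [hw₀]
    exact lt_min (lt_min (lt_min hw₁ hw₂) (lt_min hwa0 (Real.exp_pos _)))
      (lt_min (Real.exp_pos _) (by norm_num))
  refine ⟨2, c₀, w₀, two_pos, hc₀0, hw₀0, ?_⟩
  intro w hw n hn hwn
  obtain ⟨hw0, hwle⟩ := hw
  have hww₁ : w ∈ Set.Ioc 0 w₁ :=
    ⟨hw0, hwle.trans ((min_le_left _ _).trans ((min_le_left _ _).trans (min_le_left _ _)))⟩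
  have hww₂ : w ∈ Set.Ioc 0 w₂ :=
    ⟨hw0, hwle.trans ((min_le_left _ _).trans ((min_le_left _ _).trans (min_le_right _ _)))⟩
  have hwwa : w ≤ wa := hwle.trans ((min_le_left _ _).trans ((min_le_right _ _).trans (min_le_left _ _)))
  have hwwb : w ≤ wb := hwle.trans ((min_le_left _ _).trans ((min_le_right _ _).trans (min_le_right _ _)))
  have hwwc : w ≤ wc := hwle.trans ((min_le_right _ _).trans (min_le_left _ _))
  have hw5 : w ≤ 1 / 5 := hwle.trans ((min_le_right _ _).trans (min_le_right _ _))
  have hw1 : w ≤ 1 := by linarith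
  -- `L = log(1/w) ≥ 4(log 2 + C₃) > 0`
  set L : ℝ := -Real.log w with hL
  have hL4 : 4 * (Real.log 2 + C₃) ≤ L := by
    have := Real.log_le_log hw0 hwwc
    rw [hwc, Real.log_exp] at this
    rw [hL]; linarith
  have hlog2 : 0 < Real.log 2 := Real.log_pos (by norm_num)
  have hL0 : 0 < L := by linarith
  have hLw : L * w ≤ 1 := by rw [mul_comm]; exact jb_mul_neg_log_le_one hw0
  -- `log ϑ ≤ log 2 + log w`
  have hθpos := ahTheta_pos hw0
  have hθle : Real.log (ahTheta w) ≤ Real.log 2 + Real.log w := by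
    have h1 : ahTheta w ≤ 2 * w := by
      have := ahTheta_le hw0.le hw5
      nlinarith [pow_le_one₀ hw0.le hw1 (n := 2)]
    rw [← Real.log_mul (by norm_num) hw0.ne']
    exact Real.log_le_log hθpos h1
  have hlogc₀ : Real.log c₀ = Real.log 2 + (1 + C₃ + 2 * C₄) := by
    rw [hc₀, Real.log_mul (by norm_num) (Real.exp_pos _).ne', Real.log_exp]
  -- the product space
  set μ : Measure (Fin n → ℝ) := Measure.pi fun _ : Fin n => ρB with hμ
  have hae : ∀ᵐ B ∂μ, ∀ i, bm ≤ B i ∧ B i ≤ bp := ae_pi_mem_Icc hτ.eq_zero hρ n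
  set sw := Real.sqrt w with hsw
  have hsw0 : 0 ≤ sw := Real.sqrt_nonneg _
  have hswpos : 0 < sw := Real.sqrt_pos.mpr hw0
  -- the rates
  have hrate1 : Real.exp (-(κ₀ / w)) ≤ w ^ α := jb_exp_neg_inv_le_rpow hκ₀0 hα hw0 hwwa
  have hrate2 : (n : ℝ) * Real.exp (-(κ₁ * Real.log w ^ 2)) ≤ w ^ α :=
    jb_nat_mul_exp_neg_log_sq_le_rpow hκ₁0 hα hw0 hwwb hwn
  have hsize : ∀ j, j ≤ n → μ.real {B | L / 4 ≤ jbSum w (jbGN w) (ahTheta w) 0 (finExt B) j} ≤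
      Real.exp (-(κ₁ * Real.log w ^ 2)) := by
    intro j hj
    have h := jb_size_tail hτ ρB hρ hw0 hj hwn hL0.le hLw (ahTheta w) 0
    rw [← hM] at h
    rw [hκ₁]
    calc _ ≤ Real.exp (-(1 / (64 * jbA₂ M) * L ^ 2)) := h
      _ = Real.exp (-(1 / (64 * jbA₂ M) * Real.log w ^ 2)) := by rw [hL, neg_sq]
  have hbadsum : ∑ j ∈ Finset.range n, μ.real {B | L / 4 ≤ jbSum w (jbGN w) (ahTheta w) 0 (finExt B) j} ≤
      w ^ α := by
    calc ∑ j ∈ Finset.range n, μ.real {B | L / 4 ≤ jbSum w (jbGN w) (ahTheta w) 0 (finExt B) j}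
        ≤ ∑ _j ∈ Finset.range n, Real.exp (-(κ₁ * Real.log w ^ 2)) :=
          Finset.sum_le_sum fun j hj => hsize j (Finset.mem_range.mp hj).le
      _ = n * Real.exp (-(κ₁ * Real.log w ^ 2)) := by
          rw [Finset.sum_const, Finset.card_range, nsmul_eq_mul]
      _ ≤ w ^ α := hrate2
  -- deterministic facts along a.e. trajectory
  have htraj : ∀ B : Fin n → ℝ, (∀ i, bm ≤ B i ∧ B i ≤ bp) →
      (∀ j, 0 < jbDiff w (finExt B) j) ∧
      (∀ j, |Real.log (jbDiff w (finExt B) j) - Real.log (ahTheta w) -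
          jbSum w (jbGN w) (ahTheta w) 0 (finExt B) j| ≤ C₃ * w ^ 2 * j) ∧
      (Real.log (ahGamma w 0 (finExt B) n) - Real.log (ahGamma w (ahTheta w) (finExt B) n) ≤
          ∑ j ∈ Finset.range n, w * (ahS (ahPhase w 0 (finExt B) j) -
            ahS (ahPhase w (ahTheta w) (finExt B) j)) * finExt B j + C₄ * (w ^ 2 * n + w)) ∧
      0 < ahGamma w (ahTheta w) (finExt B) n ∧ 0 < ahGamma w 0 (finExt B) n := by
    intro B hB
    have hBk : ∀ k, finExt B k ∈ Set.Icc bm bp := by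
      intro k
      by_cases hk : k < n
      · rw [finExt_of_lt _ hk]; exact ⟨(hB _).1, (hB _).2⟩
      · simp only [finExt, dif_neg hk]; exact ⟨hbm0, hbp0⟩
    obtain ⟨hpos, hlog⟩ := hrec w hww₁ (finExt B) hBk
    obtain ⟨hg1, hg2, hg3⟩ := hgam w hww₂ (finExt B) hBk n
    exact ⟨hpos, hlog, hg3, hg1, hg2⟩
  -- the bad events `{d_j > √w} ⊆ {N_j ≥ L/4}`
  have hbad : ∀ B : Fin n → ℝ, (∀ i, bm ≤ B i ∧ B i ≤ bp) → ∀ j, j ≤ n →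
      sw < jbDiff w (finExt B) j → L / 4 ≤ jbSum w (jbGN w) (ahTheta w) 0 (finExt B) j := by
    intro B hB j hj hdj
    obtain ⟨hpos, hlog, -, -, -⟩ := htraj B hB
    have h1 := (abs_le.mp (hlog j)).2
    have h2 : Real.log sw < Real.log (jbDiff w (finExt B) j) := Real.log_lt_log hswpos hdj
    have h3 : Real.log sw = Real.log w / 2 := by rw [hsw]; exact Real.log_sqrt hw0.le
    have hwj : C₃ * w ^ 2 * j ≤ C₃ := by
      have hjn : (j : ℝ) ≤ n := by exact_mod_cast hj
      have hw2 : 0 ≤ w ^ 2 := sq_nonneg w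
      have : w ^ 2 * j ≤ 1 := (mul_le_mul_of_nonneg_left hjn hw2).trans hwn
      nlinarith
    have hL' : Real.log w = -L := by rw [hL]; ring
    rw [hL'] at h3 hθle
    linarith
  -- claim (1)
  have hclaim1 : ∀ R : ℝ, μ.real {B | Real.exp (ahMart w (finExt B) n) ≤ R ∧
      c₀ * R * w < ahPhase w (ahTheta w) (finExt B) n - ahPhase w 0 (finExt B) n} ≤ 2 * w ^ α := by
    intro R
    have hincl : ∀ᵐ B ∂μ, B ∈ {B | Real.exp (ahMart w (finExt B) n) ≤ R ∧
        c₀ * R * w < ahPhase w (ahTheta w) (finExt B) n - ahPhase w 0 (finExt B) n} →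
        B ∈ {B | 1 ≤ jbSum w (jbGL w) (ahTheta w) 0 (finExt B) n} ∨
          ∃ j < n, B ∈ {B | L / 4 ≤ jbSum w (jbGN w) (ahTheta w) 0 (finExt B) j} := by
      refine hae.mono fun B hB hS => ?_
      simp only [Set.mem_setOf_eq] at hS ⊢
      obtain ⟨hR, hd⟩ := hS
      obtain ⟨hpos, hlog, -, -, -⟩ := htraj B hB
      by_cases hgood : ∀ j < n, jbDiff w (finExt B) j ≤ sw
      · left
        have hsumL : jbSum w (jbGL w) (ahTheta w) 0 (finExt B) n =
            jbSum w (jbGN w) (ahTheta w) 0 (finExt B) n - ahMart w (finExt B) n := by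
          unfold jbSum ahMart
          rw [Finset.mul_sum, ← Finset.sum_sub_distrib]
          refine Finset.sum_congr rfl fun j hj => ?_
          have hjn := Finset.mem_range.mp hj
          have hcond : 0 < ahPhase w (ahTheta w) (finExt B) j - ahPhase w 0 (finExt B) j ∧
              ahPhase w (ahTheta w) (finExt B) j - ahPhase w 0 (finExt B) j ≤ Real.sqrt w :=
            ⟨hpos j, hgood j hjn⟩
          unfold jbGL
          rw [if_pos hcond]
          ring
        rw [hsumL]
        have hdn : jbDiff w (finExt B) n =
            ahPhase w (ahTheta w) (finExt B) n - ahPhase w 0 (finExt B) n := rfl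
        have hexpM := Real.exp_pos (ahMart w (finExt B) n)
        have hlow : c₀ * w * Real.exp (ahMart w (finExt B) n) < jbDiff w (finExt B) n := by
          rw [hdn]
          calc c₀ * w * Real.exp (ahMart w (finExt B) n) ≤ c₀ * w * R :=
                mul_le_mul_of_nonneg_left hR (by positivity)
            _ = c₀ * R * w := by ring
            _ < _ := hd
        have hlow' : Real.log c₀ + Real.log w + ahMart w (finExt B) n <
            Real.log (jbDiff w (finExt B) n) := by
          have := Real.log_lt_log (by positivity) hlow
          rwa [Real.log_mul (by positivity) hexpM.ne', Real.log_mul hc₀0.ne' hw0.ne',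
            Real.log_exp] at this
        have hup := (abs_le.mp (hlog n)).2
        have hwn' : C₃ * w ^ 2 * n ≤ C₃ * 1 := by
          rw [mul_assoc]; exact mul_le_mul_of_nonneg_left hwn hC₃
        rw [hlogc₀] at hlow'
        linarith
      · right
        push Not at hgood
        obtain ⟨j, hjn, hdj⟩ := hgood
        exact ⟨j, hjn, hbad B hB j hjn.le hdj⟩
    have hT := jb_trunc_tail hτ ρB hρ hw0 hw1 hwn (measurable_jbGL w) (abs_jbGL_le hw0.le) (ahTheta w) 0
    rw [← hM, ← hκ₀] at hT
    have hunion := jb_measureReal_le_of_ae_subset μ hincl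
    linarith
  -- claim (2)
  have hclaim2 : μ.real {B | c₀ * ahGamma w (ahTheta w) (finExt B) n < ahGamma w 0 (finExt B) n} ≤
      2 * w ^ α := by
    have hincl : ∀ᵐ B ∂μ, B ∈ {B | c₀ * ahGamma w (ahTheta w) (finExt B) n < ahGamma w 0 (finExt B) n} →
        B ∈ {B | 1 ≤ jbSum w (jbGK w) (ahTheta w) 0 (finExt B) n} ∨
          ∃ j < n, B ∈ {B | L / 4 ≤ jbSum w (jbGN w) (ahTheta w) 0 (finExt B) j} := by
      refine hae.mono fun B hB hS => ?_
      simp only [Set.mem_setOf_eq] at hS ⊢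
      obtain ⟨hpos, -, hgr, hg1, hg2⟩ := htraj B hB
      by_cases hgood : ∀ j < n, jbDiff w (finExt B) j ≤ sw
      · left
        have hsumK : jbSum w (jbGK w) (ahTheta w) 0 (finExt B) n =
            ∑ j ∈ Finset.range n, w * (ahS (ahPhase w 0 (finExt B) j) -
              ahS (ahPhase w (ahTheta w) (finExt B) j)) * finExt B j := by
          unfold jbSum
          refine Finset.sum_congr rfl fun j hj => ?_
          have hjn := Finset.mem_range.mp hj
          have hcond : 0 < ahPhase w (ahTheta w) (finExt B) j - ahPhase w 0 (finExt B) j ∧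
              ahPhase w (ahTheta w) (finExt B) j - ahPhase w 0 (finExt B) j ≤ Real.sqrt w :=
            ⟨hpos j, hgood j hjn⟩
          unfold jbGK
          rw [if_pos hcond]
        rw [hsumK]
        have hlow : Real.log c₀ + Real.log (ahGamma w (ahTheta w) (finExt B) n) <
            Real.log (ahGamma w 0 (finExt B) n) := by
          have := Real.log_lt_log (by positivity) hS
          rwa [Real.log_mul hc₀0.ne' hg1.ne'] at this
        have hwn' : C₄ * (w ^ 2 * n + w) ≤ C₄ * 2 := mul_le_mul_of_nonneg_left (by linarith) hC₄
        rw [hlogc₀] at hlow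
        linarith
      · right
        push Not at hgood
        obtain ⟨j, hjn, hdj⟩ := hgood
        exact ⟨j, hjn, hbad B hB j hjn.le hdj⟩
    have hX : 0 ≤ π ^ 2 * w * Real.sqrt w := by positivity
    have hGK : ∀ x y, |jbGK w x y| ≤ 3 * π ^ 2 * w * Real.sqrt w := fun x y =>
      (abs_jbGK_le hw0.le x y).trans (by linarith)
    have hT := jb_trunc_tail hτ ρB hρ hw0 hw1 hwn (measurable_jbGK w) hGK (ahTheta w) 0
    rw [← hM, ← hκ₀] at hT
    have hunion := jb_measureReal_le_of_ae_subset μ hincl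
    linarith
  exact ⟨hclaim1, hclaim2⟩

end Literature.Barriers.AtomisticToContinuum

end
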